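import Summits.AtomisticToContinuum.BoseEinsteinCondensation.Theorems.InfraredMinimumUncertainty.Negative.FisherGaussianityLoadBearing
import Summits.AtomisticToContinuum.BoseEinsteinCondensation.Theorems.InfraredMinimumUncertainty.Negative.FreeMinimisersConstant

/-!
# Disproof work file for crux `InfraredMinimumUncertainty` (stmt-AtomisticToContinuum-11784)

Standing adversary file (cdisprove; generation 1 → **generation 2, cycle 2, 2026-08-16T03:30Z**) on the
crux `BECConjugateDomination.InfraredMinimumUncertainty` (IMU): for every smooth-class `v` there are
`C ≥ 0`, `ρ₀ > 0` with `Π_m := N·ν_m·S_m ≤ C` for every positive torus MINIMISER, every `m ≠ 0`,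
eventually in `N`, for all `ρ < ρ₀` (`ν_m` = Lévy weight `Re ĉ_m(log g)` of the translation-averaged
coherence `g`, `S_m` = uncentred static structure factor of the SAME state).
Prose lives in docstrings only.  **No `sorry` in this generation** (the generation-1 near-miss §G is
CLOSED in the registered V-form, §H).

## Generation-1 content is LANDED (all `--supports stmt-AtomisticToContinuum-11784`, namespace
## `Summit.AtomisticToContinuum.BoseEinsteinCondensation.Theorems.InfraredMinimumUncertainty.Negative`,
## imported and `open`ed below — every gen-1 name of this file now resolves THERE):

* `Negative/CellShiftToolkit.lean` (p73268) — §T toolkit (`arg_add`, `integral_cell_sin_arg`,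
  `integral_cell_cos_arg_add`, `phiMode_shift_mul`, `integral_cell_phiMode_shift_mul`,
  `mul_log_one_add_mul_ge`, `integral_cellN_prod_real`, `sq_integral_le_integral_sq`).
* `Negative/CoherenceBounds.lean` (p74268) — §B: `0 ≤ g ≤ 1 = g(0)` for EVERY admissible state
  (`coherence_le_one/zero/nonneg`, `log_coherence_nonpos`), `levyWeight_zero_nonpos`,
  `structureFactor_zero` (`S₀ = N`), `pi_zero_nonpos`, `imu_iff_allModes` (**`m ≠ 0` not load-bearing**).
* `Negative/FreeDensityWave.lean` (p74273), `Negative/FreeDensityWaveBragg.lean` (p74651) — §W: the free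
  density wave `waveState n L ε = (c(1+2ε cos θ_{e₀}))^{⊗N}` with `coherence_waveState`
  (`g = (1+2ε²cos θ)/(1+2ε²)` exactly), `levyWeight_waveState_ge` (`ν_{e₀} ≥ ε²(1−2ε²)`),
  `structureFactor_waveState_ge` (`S_{e₀} ≥ 4ε²N/(1+2ε²)²`, Bragg peak), `periodicEnergy_waveState_le`
  (`E ≤ 16π²ε²N/L²`), `pi_waveState_ge` (`Π_{e₀} ≥ 2ε⁴N²`).
* `Negative/MinimalityLoadBearing.lean` (p74897) — §A (`Body`, `imu_iff`, `inSmoothClass_zero`) and §C: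
  **MINIMALITY IS LOAD-BEARING** (`free_near_minimiser_witness`, `eventually_lt_pi_free_near_minimiser`,
  `eventually_lt_pi_free_vanishing_slack`, `not_infraredMinimumUncertaintyNearMinimisers`,
  `imu_false_without_minimality`; `Π ≍ (δL²)²` for `δ`-near-minimisers, unbounded once `δ_N L_N² → ∞`).
* `Negative/FreeMinimisersConstant.lean` (p74664) — §E positive control: free minimisers are constants,
  `E₀^per(0) = 0`, `g ≡ 1`, `ν ≡ 0`, `body_zero` (**the crux's body is TRUE at `v ≡ 0` with `C = 0`**).
* `Negative/DensityWaveFisherMoments.lean` (p75247), `Negative/FisherGaussianityLoadBearing.lean`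
  (p75542) — §F: `affineField`, `fisherTest_affineField` (`J = 2λ − λ²Var Re Z`), two-index Fubini,
  `variance_re_densityMode_waveState_le` (`Var Re Z ≤ N`), `not_fisherGaussianityNearMinimisers`,
  `fisherGaussianity_false_without_minimality` (planar gen-1 form of FG).

## Findings of generation 2 (this cycle) — §H below (work-file copies; landing as
## `Negative/DensityWaveCommutator.lean` + `Negative/LadderLoadBearing.lean`)

* **The commutator amplitude of the density wave has NO Bragg component.**  For the free density wave
  at its own mode, `W := [−Δ, Z_{e₀}]Ψ = ∑ⱼ e(xⱼ)(‖k‖²Ψ − 2i∂_{xⱼ·k}Ψ) = ‖k‖² ∑ⱼ β(xⱼ)∏_{i≠j}φ(xᵢ)`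
  (`commutatorAmp_waveFun`, `β = e·c(φ_ε + 4iε sin θ)`), and `∫_cell β φ = 0`
  (`integral_cell_betaFactor_mul_waveFactorC` — the one-body identity `∫e^{iθ}(f² − i∂_θ f²)dθ = 0`,
  i.e. `⟨Ψ,[−Δ,Z]Ψ⟩ = 0` realised slot by slot).  Hence, by the slot calculus
  (`integral_cellN_prod_complex`, `slotFun`, `integral_slotFun_mul_slotFun`):
  **`m₂ = ‖W‖² = N‖k‖⁴(1+10ε²)/(1+2ε²)`** EXACTLY (`secondMoment_waveFun`) — `O(N‖k‖⁴)`, no `N²ε²`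
  term, although `S_{e₀} ≍ ε²N` is a Bragg peak; `∫WΨ̄ = 0`, `Re∫Z̄WΨ̄ = N‖k‖²` (f-sum, as it must:
  `integral_conj_densityMode_mul_commutatorAmp_waveFun`), `∫ZWΨ̄ = −N‖k‖²ε²/(1+2ε²)`
  (`= −‖k‖²E[Z_{2e₀}]`, exactly the Stein prediction: `integral_densityMode_mul_commutatorAmp_waveFun`).
* **The AM–GM rung, for every state** (`fisherTestV_le_secondMoment`): `J^V_m(φ) ≤ 4m₂/(N²‖k‖⁴)` for
  every admissible `Ψ`, `m ≠ 0`, continuous `φ` (completion of the square under the integral; this is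
  the data-processing step `FD ⇒ DMD` of the line, re-proved here negative-side).
* **EVERY RUNG OF THE PICKED LADDER NEEDS MINIMALITY** (`FrameNearMinimisers` / `FrameWithoutMinimality`
  = `CruxFrame` with `E = E₀` weakened to `E ≤ E₀ + δ`, `δ` before `N` / deleted; bodies `dmdBody`,
  `fsBody`, `fdVBody`, `fgVBody` certified `Iff.rfl` against `DensityMomentDomination`,
  `FeynmanSaturation`, `FisherDominationV`, `FisherGaussianityV`):
  `ladder_free_near_minimiser_witness` (slack `δ`, `ε² = min(1/16, δL²/(16π²N))`, `T := min(N/16,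
  δL²/(16π²)) → ∞`: `Nν ≥ (7/8)T`, `S ≥ 3T`, `N‖k‖⁴ ≤ m₂ ≤ 2N‖k‖⁴`, `J^V(φ) ≤ 8/N ∀φ`,
  `J^V(φ_{1/N,μ_N}) ≥ (8/9)/N`) gives
  - `not_dmdNearMinimisers`, `dmd_false_without_minimality` — **DMD** (`4N²‖k‖⁴ν ≤ Cm₂`) is FALSE for
    near-minimisers: `4N²‖k‖⁴ν/m₂ ≍ Nε² ≍ δL²`;
  - `not_fsNearMinimisers`, `fs_false_without_minimality` — **Feynman saturation** `m₀m₂ ≤ Cm₁²` is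
    FALSE for near-minimisers (`m₀ = NS` is the Bragg peak, `m₂ ≈ m₁²/N`);
  - `not_fdVNearMinimisers`, `fdV_false_without_minimality` — **FD in its REGISTERED V-form**
    (`stub_phaseSteinDomination` is its Stein rewriting) is FALSE for near-minimisers:
    `sup_φ J^V ≤ 8/N` while `16ν ≍ ε²`.  **This closes the generation-1 near-miss §G** ("FD also needs
    minimality", then blocked on a Fisher-information upper bound for the law of `Z`): in the lifted
    V-form the upper bound is the AM–GM rung plus `m₂ = O(N‖k‖⁴)`, no density of the law of `Z` needed;
  - `not_fgVNearMinimisers`, `fgV_false_without_minimality` — **FG in its REGISTERED V-form**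
    (`stub_densityFisherGaussianity` verbatim) is FALSE for near-minimisers:
    `J^V(φ_{1/N,μ_N})·(NS) ≥ (8/3)T → ∞` (centred affine field; pairing `2λ(1+ε²)/(1+2ε²)` from the
    `Z`/`Z̄` pairings, minus `λ²Var Re Z ≤ λ²N`).
  So the provers of BOTH registered analytic stubs, and of both typed fallbacks DMD / FS, must use the
  exact minimiser property below every `N`-uniform energy resolution (threshold: slack `δ_N` with
  `δ_N L_N² → ∞` already kills; `δ = O(L⁻²)` = first torus gap is the natural scale).  Only SMB
  (`m₂ ≤ CN‖k‖³√(‖k‖²+ρ)`) survives the density-wave test (there `m₂ ≈ N‖k‖⁴`).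

## `-- Targets` (generation 2): the lead's reshaped skeleton r1 (02:29:50Z), stubs
## `stub_steinIdentity`, `stub_weakEulerLagrange`, `stub_coherenceRegular`, `stub_phaseSteinDomination`,
## `stub_densityFisherGaussianity` — see the docstring of `targets_note_gen2` at the end of the file.

## Why the crux still resists (generation 2 summary; generation-1 analysis stands)

* No formal junk, no degenerate kill (gen 1: §B, §E; `v ≡ 0` true with `C = 0`; `m = 0`, `N = 1`, UV all
  harmless); the content is `N`-uniformity at the lowest modes for interacting `v`, where `∀ Ψ` ranges
  over ONE function (the positive ground state) with no closed form in `d = 3`.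
* A counterexample needs a positive ground state of a smooth repulsive finite-range `v` at arbitrarily
  small `ρ` with NO BEC or an anomalous (non-phonon / log-dressed) infrared branch — as open as the
  conjunct.  The expected `Π → ∞` regimes are all at HIGH density, excluded by `ρ < ρ₀`: in `d = 3` the
  cluster/quantum crystal (`S_G ≍ N`, `ν_G = O(1)`, `Π_G ≍ N`); the `d = 1` analogue is quantitative
  and exactly solvable: a Luttinger liquid of parameter `K` has, at the umklapp mode `2k_F`,
  `S_{2k_F} ≍ L^{1−2K}`, `ν_{2k_F} ≍ L^{−2K}`, `Π_{2k_F} ≍ L^{2−4K} → ∞` iff `K < 1/2` (hard rods: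
  `K = (1−ρa)²`, i.e. `ρa > 1 − 2^{−1/2}`; Mazzanti et al. 2008, quasi-Bragg peaks), while at LOW density
  `K → 1` and `Π_m ≤ 1/4` at every mode (Tonks: `Nν_m = N/(4|m|)`, `S_m = |m|/N`, `Π ≡ 1/4` for
  `|m| ≤ N` — the census value `0.2458…0.2490` from below).  So `ρ < ρ₀` is load-bearing in every
  dimension, and the `d = 3`, low-density statement is BEC-hard, not cheaply false.
* FG (registered form) in regression language: `sup_φ J^V_m(φ) = (4/(N²‖k‖⁴))‖E[A | Z]‖²` with
  `A = W/Ψ = (H−E₀)(ZΨ)/Ψ`, and the Dirichlet-form identity `E[f̄(Z)A] = ‖k‖²E[N conj∂f(Z) −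
  conj∂̄f(Z)·Z_{2m}]` (= `stub_steinIdentity`): FG says the regression of the excitation amplitude `A`
  on the density mode `Z` is LINEAR up to constants (linear part gives exactly `J^V·NS = 4` on every real
  state: f-sum + Cramér–Rao, so FG's constant is `≥ 4`, `= 4` at `v ≡ 0` — landed `fisherGaussianity_free`
  — and Bogoliubov-exact); it depends on the state only through the joint law of `(Z_m, Z_{2m})`.
  No cheap kill for minimisers (ideator census j006302: regression saturation ≤ 1.11 at the lowest modes).
* FD (registered V/Stein form) is a proved consequence of the crux (`fisherDomination_of_imu`); with the
  optimal LINEAR field it IS the crux; the nonlinear freedom only tests the law of `(Z_m, Z_{2m})`.  §H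
  shows its prover must use exact minimality at first-gap resolution (false at any `N`-uniform slack).
-/

noncomputable section

open MeasureTheory Filter Set
open scoped ENNReal NNReal Topology ComplexConjugate BigOperators

namespace Summit.AtomisticToContinuum.BoseEinsteinCondensation.Cruxes.InfraredMinimumUncertainty.Disproof

open Literature.MathematicalPhysics.QuantumManyBody.BoseGas
open Summit.AtomisticToContinuum.BoseEinsteinCondensation.Theses.BECConjugateDomination
open Summit.AtomisticToContinuum.BoseEinsteinCondensation.Cruxes.InfraredMinimumUncertainty.FisherGaussianDensityMode
open Summit.AtomisticToContinuum.BoseEinsteinCondensation.Theorems.InfraredMinimumUncertainty.Negative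
open Summit.AtomisticToContinuum.BoseEinsteinCondensation.Theorems.GaussianDominationCan.Negative
  (prodFun contDiff_prodFun fderiv_prodFun)
open Summit.AtomisticToContinuum.BoseEinsteinCondensation.Theorems.StaticResponseBound.Negative
  (arg re_cellWave integral_norm_sq_eq_one phiMode argCLM argCLM_apply integral_cell_trig_combo
    phiMode_sq integral_cell_phiMode_sq arg_intSMul isRepulsiveFiniteRange_zero)
open Summit.AtomisticToContinuum.BoseEinsteinCondensation.Theorems.CorrectorClosure.Negative
  (e0 e0_ne_zero sideLength_succ_pos)

/-! ## §H  (gen 2) The commutator amplitude of the density wave; every ladder rung needs minimality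

Work-file copies of `neg/DensityWaveCommutator.lean` + `neg/LadderLoadBearing.lean` (landing as
`Theorems/InfraredMinimumUncertainty/Negative/{DensityWaveCommutator,LadderLoadBearing}.lean`,
`--supports stmt-AtomisticToContinuum-11784`); to be slimmed to imports once landed. -/


/-! ### Slot calculus for product states on `cell^N` -/

section SlotCalculus

variable {L : ℝ} {N : ℕ}

/-- Fubini for products of COMPLEX one-body factors on `cell^N`. [folklore] -/
theorem integral_cellN_prod_complex (f : Fin N → Space → ℂ) :
    ∫ X in cellN N L, ∏ i, f i (X i) = ∏ i, ∫ x in cell L, f i x := by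
  rw [volume_restrict_cellN]
  exact integral_fintype_prod_eq_prod (𝕜 := ℂ) f

/-- The one-slot insertion `a^{(j)}(X) = a(xⱼ) · ∏_{i ≠ j} f(xᵢ)` into the product state `f^{⊗N}`. -/
def slotFun (f a : Space → ℂ) (j : Fin N) (X : Config N) : ℂ :=
  a (X j) * ∏ i ∈ Finset.univ.erase j, f (X i)

/-- `a^{(j)}` as a full product over the slots. [folklore] -/
theorem slotFun_eq_prod (f a : Space → ℂ) (j : Fin N) (X : Config N) :
    slotFun f a j X = ∏ i, (if i = j then a else f) (X i) := by
  unfold slotFun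
  rw [← Finset.mul_prod_erase Finset.univ (fun i => (if i = j then a else f) (X i))
    (Finset.mem_univ j)]
  simp only [if_true]
  congr 1
  exact Finset.prod_congr rfl fun i hi => by rw [if_neg (Finset.ne_of_mem_erase hi)]

/-- **Slot-pair integrals** under a factor with `∫_cell f² = 1`: the diagonal pair gives
`∫_cell a b`, an off-diagonal pair factorises as `(∫_cell a f)(∫_cell b f)`. [folklore] -/
theorem integral_slotFun_mul_slotFun {f : Space → ℂ} (hf1 : ∫ x in cell L, f x * f x = 1)
    (a b : Space → ℂ) (j l : Fin N) :
    ∫ X in cellN N L, slotFun f a j X * slotFun f b l X =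
      if j = l then ∫ x in cell L, a x * b x
      else (∫ x in cell L, a x * f x) * ∫ x in cell L, b x * f x := by
  have hpt : ∀ X : Config N, slotFun f a j X * slotFun f b l X =
      ∏ i, ((if i = j then a else f) (X i) * (if i = l then b else f) (X i)) := by
    intro X
    rw [slotFun_eq_prod, slotFun_eq_prod, ← Finset.prod_mul_distrib]
  simp_rw [hpt]
  rw [integral_cellN_prod_complex (fun i x => (if i = j then a else f) x * (if i = l then b else f) x)]
  set F : Fin N → ℂ := fun i => ∫ x in cell L, (if i = j then a else f) x * (if i = l then b else f) x
    with hF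
  change ∏ i, F i = _
  rw [← Finset.mul_prod_erase Finset.univ F (Finset.mem_univ j)]
  by_cases hjl : j = l
  · subst hjl
    have hFj : F j = ∫ x in cell L, a x * b x := by simp only [hF, if_true]
    have hFi : ∀ i ∈ Finset.univ.erase j, F i = 1 := fun i hi => by
      simp only [hF, if_neg (Finset.ne_of_mem_erase hi)]
      exact hf1
    rw [if_pos rfl, hFj, Finset.prod_eq_one hFi, mul_one]
  · have hFj : F j = ∫ x in cell L, a x * f x := by simp only [hF, if_true, if_neg hjl]
    have hl : l ∈ Finset.univ.erase j := Finset.mem_erase.mpr ⟨Ne.symm hjl, Finset.mem_univ l⟩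
    have hFl : F l = ∫ x in cell L, b x * f x := by
      simp only [hF, if_true, if_neg (Ne.symm hjl)]
      exact integral_congr_ae (Eventually.of_forall fun x => mul_comm _ _)
    have hFi : ∀ i ∈ (Finset.univ.erase j).erase l, F i = 1 := fun i hi => by
      have hil : i ≠ l := Finset.ne_of_mem_erase hi
      have hij : i ≠ j := Finset.ne_of_mem_erase (Finset.mem_of_mem_erase hi)
      simp only [hF, if_neg hil, if_neg hij]
      exact hf1
    rw [if_neg hjl, ← Finset.mul_prod_erase _ F hl, hFj, hFl, Finset.prod_eq_one hFi, mul_one]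

end SlotCalculus

/-! ### The plane wave through the phase; the wave vector of the mode `e₀` -/

section Phase

variable {L : ℝ}

/-- `e_k(x) = exp(i θ_k(x))`. [folklore] -/
theorem cellWave_eq_exp_arg (L : ℝ) (k : Fin 3 → ℤ) (x : Space) :
    cellWave L k x = Complex.exp ((arg L k x : ℂ) * Complex.I) := by
  rw [cellWave_apply]
  congr 1
  unfold arg
  push_cast
  ring

/-- `e_k = cos θ_k + i sin θ_k`. [folklore] -/
theorem cellWave_eq_cos_add_sin (L : ℝ) (k : Fin 3 → ℤ) (x : Space) :
    cellWave L k x = (Real.cos (arg L k x) : ℂ) + (Real.sin (arg L k x) : ℂ) * Complex.I := by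
  rw [cellWave_eq_exp_arg, Complex.exp_mul_I, Complex.ofReal_cos, Complex.ofReal_sin]

/-- `e_k ē_k = 1`. [folklore] -/
theorem cellWave_mul_conj (L : ℝ) (k : Fin 3 → ℤ) (x : Space) :
    cellWave L k x * conj (cellWave L k x) = 1 := by
  rw [Complex.mul_conj, Complex.normSq_eq_norm_sq, norm_cellWave]
  simp

/-- `2 cos θ_k = e_k + ē_k`. [folklore] -/
theorem two_cos_arg_eq (L : ℝ) (k : Fin 3 → ℤ) (x : Space) :
    (2 * Real.cos (arg L k x) : ℂ) = cellWave L k x + conj (cellWave L k x) := by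
  rw [cellWave_eq_cos_add_sin, map_add, map_mul, Complex.conj_ofReal, Complex.conj_ofReal,
    Complex.conj_I]
  ring

/-- `2i sin θ_k = e_k − ē_k`. [folklore] -/
theorem two_sin_arg_mul_I_eq (L : ℝ) (k : Fin 3 → ℤ) (x : Space) :
    (2 * Real.sin (arg L k x) : ℂ) * Complex.I = cellWave L k x - conj (cellWave L k x) := by
  rw [cellWave_eq_cos_add_sin, map_add, map_mul, Complex.conj_ofReal, Complex.conj_ofReal,
    Complex.conj_I]
  ring

/-- `∫_cell e_k^2 = 0`, `∫_cell e_k^3 = 0`, `∫_cell ē_k = 0` for `k ≠ 0` (as integrals of the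
plane waves `e_{2k}`, `e_{3k}`, `e_{-k}`). [folklore] -/
theorem add_self_ne_zero_of_ne {k : Fin 3 → ℤ} (hk : k ≠ 0) : k + k ≠ 0 := by
  intro h
  apply hk
  funext j
  have := congrFun h j
  simp only [Pi.add_apply, Pi.zero_apply] at this
  simp only [Pi.zero_apply]
  omega

theorem add_self_add_self_ne_zero_of_ne {k : Fin 3 → ℤ} (hk : k ≠ 0) : k + k + k ≠ 0 := by
  intro h
  apply hk
  funext j
  have := congrFun h j
  simp only [Pi.add_apply, Pi.zero_apply] at this
  simp only [Pi.zero_apply]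
  omega

theorem integral_cell_cellWave_sq (hL : 0 < L) {k : Fin 3 → ℤ} (hk : k ≠ 0) :
    ∫ x in cell L, cellWave L k x * cellWave L k x = 0 := by
  simp_rw [← cellWave_add_index]
  exact integral_cell_cellWave_eq_zero hL (add_self_ne_zero_of_ne hk)

theorem integral_cell_cellWave_cube (hL : 0 < L) {k : Fin 3 → ℤ} (hk : k ≠ 0) :
    ∫ x in cell L, cellWave L k x * cellWave L k x * cellWave L k x = 0 := by
  simp_rw [← cellWave_add_index]
  exact integral_cell_cellWave_eq_zero hL (add_self_add_self_ne_zero_of_ne hk)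

theorem integral_cell_conj_cellWave (hL : 0 < L) {k : Fin 3 → ℤ} (hk : k ≠ 0) :
    ∫ x in cell L, conj (cellWave L k x) = 0 := by
  simp_rw [conj_cellWave]
  exact integral_cell_cellWave_eq_zero hL (neg_ne_zero.mpr hk)

/-- `∫_cell e_k ē_k = L³`. [folklore] -/
theorem integral_cell_cellWave_mul_conj (hL : 0 < L) (k : Fin 3 → ℤ) :
    ∫ x in cell L, cellWave L k x * conj (cellWave L k x) = (L : ℂ) ^ 3 := by
  simp_rw [cellWave_mul_conj]
  have h := integral_cell_cellWave_zero hL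
  simp_rw [cellWave_zero] at h
  exact h

/-- `‖k‖² = (2π/L)²` for the mode `e₀`. [folklore] -/
theorem norm_waveVec_e0_sq (L : ℝ) : ‖waveVec L e0‖ ^ 2 = (2 * Real.pi / L) ^ 2 := by
  rw [EuclideanSpace.norm_eq, Real.sq_sqrt (Finset.sum_nonneg fun i _ => by positivity)]
  simp [waveVec_apply, e0, Pi.single_apply]

/-- `θ_{e₀}(k) = ‖k‖²` for `k = waveVec L e₀`. [folklore] -/
theorem arg_waveVec_e0 (L : ℝ) : arg L e0 (waveVec L e0) = (2 * Real.pi / L) ^ 2 := by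
  unfold arg
  simp only [waveVec_apply, e0, Pi.single_apply, Fin.sum_univ_three]
  simp
  ring

end Phase

/-! ### The commutator amplitude of the free density wave -/

section WaveCommutator

variable {L : ℝ} {ε : ℝ} {n : ℕ}

/-- The derivative of the one-body factor along `k = waveVec L e₀`:
`∂_k φ_ℂ(x) = c · (−2ε sin θ(x)) · (2π/L)²` (`θ_{e₀}(k) = ‖k‖²`). [folklore] -/
theorem fderiv_waveFactorC_waveVec (L ε : ℝ) (x : Space) :
    fderiv ℝ (waveFactorC L ε) x (waveVec L e0) =
      ((cnorm L ε * (2 * ε * -Real.sin (arg L e0 x)) * (2 * Real.pi / L) ^ 2 : ℝ) : ℂ) := by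
  rw [(hasFDerivAt_waveFactorC L ε x).fderiv, ContinuousLinearMap.comp_apply,
    FunLike.coe_smul, Pi.smul_apply, argCLM_apply, arg_waveVec_e0, smul_eq_mul]
  rfl

/-- The one-body factor carried by the differentiated slot of the commutator amplitude of the
density wave: `β(x) = e_{e₀}(x) · c (φ_ε(x) + 4iε sin θ(x))`. -/
def betaFactor (L ε : ℝ) (x : Space) : ℂ :=
  cellWave L e0 x *
    (waveFactorC L ε x + ((4 * ε * cnorm L ε : ℝ) : ℂ) * ((Real.sin (arg L e0 x) : ℂ) * Complex.I))

/-- `β` is continuous. [folklore] -/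
theorem continuous_betaFactor (L ε : ℝ) : Continuous (betaFactor L ε) := by
  unfold betaFactor
  refine (continuous_cellWave L e0).mul ((continuous_waveFactorC L ε).add
    (continuous_const.mul ((Complex.continuous_ofReal.comp ?_).mul continuous_const)))
  exact Real.continuous_sin.comp (Summit.AtomisticToContinuum.BoseEinsteinCondensation.Theorems.StaticResponseBound.Negative.continuous_arg L e0)

/-- A one-slot insertion of continuous factors is continuous on configuration space. [folklore] -/
theorem continuous_slotFun {N : ℕ} {f a : Space → ℂ} (hf : Continuous f) (ha : Continuous a)
    (j : Fin N) : Continuous fun X : Config N => slotFun f a j X :=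
  (ha.comp (continuous_apply j)).mul
    (continuous_finsetProd _ fun i _ => hf.comp (continuous_apply i))

/-- **The commutator amplitude of the free density wave at its own mode**:
`W_{e₀}(X) = ∑ⱼ e(xⱼ)(‖k‖²Ψ − 2i∂_{xⱼ·k}Ψ) = ‖k‖² ∑ⱼ β(xⱼ) ∏_{i≠j} φ_ℂ(xᵢ)`. [folklore] -/
theorem commutatorAmp_waveFun (L ε : ℝ) (X : Config (n + 1)) :
    commutatorAmp (n + 1) L (waveFun n L ε) e0 X =
      (((2 * Real.pi / L) ^ 2 : ℝ) : ℂ) * ∑ j, slotFun (waveFactorC L ε) (betaFactor L ε) j X := by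
  unfold commutatorAmp
  rw [norm_waveVec_e0_sq, Finset.mul_sum]
  refine Finset.sum_congr rfl fun j _ => ?_
  have hd : ∀ _i : Fin (n + 1), Differentiable ℝ (waveFactorC L ε) := fun _ =>
    (contDiff_waveFactorC L ε).differentiable one_ne_zero
  have hprod : waveFun n L ε X =
      waveFactorC L ε (X j) * ∏ i ∈ Finset.univ.erase j, waveFactorC L ε (X i) :=
    (Finset.mul_prod_erase Finset.univ (fun i => waveFactorC L ε (X i)) (Finset.mem_univ j)).symm
  rw [show waveFun n L ε = prodFun (fun _ : Fin (n + 1) => waveFactorC L ε) from rfl,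
    fderiv_prodFun hd X j,
    show prodFun (fun _ : Fin (n + 1) => waveFactorC L ε) X = waveFun n L ε X from rfl, hprod,
    fderiv_waveFactorC_waveVec]
  unfold slotFun betaFactor waveFactorC
  push_cast
  ring

/-- `φ_ℂ` is real: `conj φ_ℂ = φ_ℂ`. [folklore] -/
theorem conj_waveFactorC (L ε : ℝ) (x : Space) : conj (waveFactorC L ε x) = waveFactorC L ε x := by
  rw [waveFactorC, Complex.conj_ofReal]

/-- `∫_cell φ_ℂ φ_ℂ = 1`. [folklore] -/
theorem integral_cell_waveFactorC_mul_self (hL : 0 < L) (ε : ℝ) :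
    ∫ x in cell L, waveFactorC L ε x * waveFactorC L ε x = 1 := by
  unfold waveFactorC
  simp_rw [← Complex.ofReal_mul, ← sq]
  rw [integral_complex_ofReal, integral_cell_waveFactor_sq hL ε, Complex.ofReal_one]

/-- `conj` of a slot insertion into the REAL product `φ_ℂ^{⊗N}`. [folklore] -/
theorem conj_slotFun_waveFactorC (L ε : ℝ) (a : Space → ℂ) (j : Fin (n + 1)) (X : Config (n + 1)) :
    conj (slotFun (waveFactorC L ε) a j X) =
      slotFun (waveFactorC L ε) (fun x => conj (a x)) j X := by
  unfold slotFun
  rw [map_mul, map_prod]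
  simp_rw [conj_waveFactorC]

/-- The real product state as a (trivial) slot insertion: `Ψ(X) = φ_ℂ(xⱼ) ∏_{i≠j} φ_ℂ(xᵢ)`. [folklore] -/
theorem waveFun_eq_slotFun (L ε : ℝ) (j : Fin (n + 1)) (X : Config (n + 1)) :
    waveFun n L ε X = slotFun (waveFactorC L ε) (waveFactorC L ε) j X :=
  (Finset.mul_prod_erase Finset.univ (fun i => waveFactorC L ε (X i)) (Finset.mem_univ j)).symm

/-- `conj Ψ = Ψ` for the real product state. [folklore] -/
theorem conj_waveFun (L ε : ℝ) (X : Config (n + 1)) : conj (waveFun n L ε X) = waveFun n L ε X := by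
  show conj (∏ i, waveFactorC L ε (X i)) = ∏ i, waveFactorC L ε (X i)
  rw [map_prod]
  simp_rw [conj_waveFactorC]

/-- **Pointwise plane-wave expansion of `β φ_ℂ`**:
`β φ_ℂ = c² ((1+2ε²) e + 4ε e² + 3ε² e³ − ε² ē)` (from `e ē = 1`, `2cos θ = e + ē`,
`2i sin θ = e − ē`). [folklore] -/
theorem betaFactor_mul_waveFactorC (L ε : ℝ) (x : Space) :
    betaFactor L ε x * waveFactorC L ε x =
      ((cnorm L ε ^ 2 : ℝ) : ℂ) * ((1 + 2 * ε ^ 2) * cellWave L e0 x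
        + 4 * ε * (cellWave L e0 x * cellWave L e0 x)
        + 3 * ε ^ 2 * (cellWave L e0 x * cellWave L e0 x * cellWave L e0 x)
        - ε ^ 2 * conj (cellWave L e0 x)) := by
  have h1 := cellWave_mul_conj L e0 x
  have hc := two_cos_arg_eq L e0 x
  have hs := two_sin_arg_mul_I_eq L e0 x
  have hc' : Complex.cos ((arg L e0 x : ℝ) : ℂ) = (cellWave L e0 x + conj (cellWave L e0 x)) / 2 := by
    rw [← Complex.ofReal_cos, ← hc]; ring
  have hs' : (Real.sin (arg L e0 x) : ℂ) * Complex.I =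
      (cellWave L e0 x - conj (cellWave L e0 x)) / 2 := by
    rw [← hs]; ring
  unfold betaFactor
  rw [hs']
  unfold waveFactorC waveFactor phiMode
  push_cast
  rw [hc']
  linear_combination ((cnorm L ε : ℂ)) ^ 2 * (2 * (ε : ℂ) ^ 2 * cellWave L e0 x
    - (ε : ℂ) ^ 2 * conj (cellWave L e0 x)) * h1

/-- **No Bragg component in the commutator amplitude**: `∫_cell β φ_ℂ = 0`. [folklore] -/
theorem integral_cell_betaFactor_mul_waveFactorC (hL : 0 < L) (ε : ℝ) :
    ∫ x in cell L, betaFactor L ε x * waveFactorC L ε x = 0 := by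
  simp_rw [betaFactor_mul_waveFactorC]
  rw [integral_const_mul]
  have ie : Integrable (cellWave L e0) (volume.restrict (cell L)) :=
    integrableOn_cell (continuous_cellWave L e0)
  have ie2 : Integrable (fun x => cellWave L e0 x * cellWave L e0 x) (volume.restrict (cell L)) :=
    integrableOn_cell ((continuous_cellWave L e0).mul (continuous_cellWave L e0))
  have ie3 : Integrable (fun x => cellWave L e0 x * cellWave L e0 x * cellWave L e0 x)
      (volume.restrict (cell L)) :=
    integrableOn_cell (((continuous_cellWave L e0).mul (continuous_cellWave L e0)).mul
      (continuous_cellWave L e0))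
  have iec : Integrable (fun x => conj (cellWave L e0 x)) (volume.restrict (cell L)) :=
    integrableOn_cell (Complex.continuous_conj.comp (continuous_cellWave L e0))
  have i1 : Integrable (fun x => (1 + 2 * (ε : ℂ) ^ 2) * cellWave L e0 x) (volume.restrict (cell L)) :=
    ie.const_mul _
  have i2 : Integrable (fun x => 4 * (ε : ℂ) * (cellWave L e0 x * cellWave L e0 x))
      (volume.restrict (cell L)) := ie2.const_mul _
  have i3 : Integrable (fun x => 3 * (ε : ℂ) ^ 2 * (cellWave L e0 x * cellWave L e0 x * cellWave L e0 x))
      (volume.restrict (cell L)) := ie3.const_mul _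
  have i4 : Integrable (fun x => (ε : ℂ) ^ 2 * conj (cellWave L e0 x)) (volume.restrict (cell L)) :=
    iec.const_mul _
  have i12 : Integrable (fun x => (1 + 2 * (ε : ℂ) ^ 2) * cellWave L e0 x
      + 4 * (ε : ℂ) * (cellWave L e0 x * cellWave L e0 x)) (volume.restrict (cell L)) := i1.add i2
  have i123 : Integrable (fun x => (1 + 2 * (ε : ℂ) ^ 2) * cellWave L e0 x
      + 4 * (ε : ℂ) * (cellWave L e0 x * cellWave L e0 x)
      + 3 * (ε : ℂ) ^ 2 * (cellWave L e0 x * cellWave L e0 x * cellWave L e0 x))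
      (volume.restrict (cell L)) := i12.add i3
  rw [integral_sub i123 i4, integral_add i12 i3, integral_add i1 i2,
    integral_const_mul, integral_const_mul, integral_const_mul, integral_const_mul,
    integral_cell_cellWave_eq_zero hL e0_ne_zero, integral_cell_cellWave_sq hL e0_ne_zero,
    integral_cell_cellWave_cube hL e0_ne_zero, integral_cell_conj_cellWave hL e0_ne_zero]
  ring

/-- `|β|² = c² (φ_ε² + 16ε² sin²θ)`. [folklore] -/
theorem norm_sq_betaFactor (L ε : ℝ) (x : Space) :
    ‖betaFactor L ε x‖ ^ 2 =
      cnorm L ε ^ 2 * (phiMode L e0 ε x ^ 2 + 16 * ε ^ 2 * Real.sin (arg L e0 x) ^ 2) := by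
  unfold betaFactor
  rw [norm_mul, norm_cellWave, one_mul, waveFactorC, waveFactor,
    show ((cnorm L ε * phiMode L e0 ε x : ℝ) : ℂ) +
        ((4 * ε * cnorm L ε : ℝ) : ℂ) * ((Real.sin (arg L e0 x) : ℂ) * Complex.I) =
      ((cnorm L ε * phiMode L e0 ε x : ℝ) : ℂ) +
        ((4 * ε * cnorm L ε * Real.sin (arg L e0 x) : ℝ) : ℂ) * Complex.I by push_cast; ring,
    Complex.sq_norm, Complex.normSq_add_mul_I]
  ring

/-- **`∫_cell |β|² = (1 + 10ε²)/(1 + 2ε²)`**. [folklore] -/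
theorem integral_cell_norm_sq_betaFactor (hL : 0 < L) (ε : ℝ) :
    ∫ x in cell L, ‖betaFactor L ε x‖ ^ 2 = (1 + 10 * ε ^ 2) / (1 + 2 * ε ^ 2) := by
  simp_rw [norm_sq_betaFactor]
  have hpt : ∀ x, cnorm L ε ^ 2 * (phiMode L e0 ε x ^ 2 + 16 * ε ^ 2 * Real.sin (arg L e0 x) ^ 2) =
      cnorm L ε ^ 2 * ((1 + 10 * ε ^ 2) + (4 * ε) * Real.cos (arg L e0 x)
        + (-6 * ε ^ 2) * Real.cos (arg L ((2 : ℤ) • e0) x)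
        + 0 * Real.cos (arg L ((3 : ℤ) • e0) x)) := by
    intro x
    rw [phiMode_sq, Real.sin_sq, Real.cos_sq (arg L e0 x)]
    simp only [arg_intSMul]
    push_cast
    ring
  simp_rw [hpt]
  rw [integral_const_mul, integral_cell_trig_combo hL e0_ne_zero,
    show cnorm L ε ^ 2 * ((1 + 10 * ε ^ 2) * L ^ 3) = (1 + 10 * ε ^ 2) * (cnorm L ε ^ 2 * L ^ 3) by ring,
    cnorm_sq_mul_cube hL, div_eq_mul_inv]

/-- `∫_cell conj(β) β = (1 + 10ε²)/(1 + 2ε²)` (complex form). [folklore] -/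
theorem integral_cell_conj_betaFactor_mul (hL : 0 < L) (ε : ℝ) :
    ∫ x in cell L, conj (betaFactor L ε x) * betaFactor L ε x =
      (((1 + 10 * ε ^ 2) / (1 + 2 * ε ^ 2) : ℝ) : ℂ) := by
  simp_rw [← Complex.normSq_eq_conj_mul_self, Complex.normSq_eq_norm_sq]
  rw [integral_complex_ofReal, integral_cell_norm_sq_betaFactor hL]

/-- **The second moment of the density wave**:
`m₂ = ∫_{cell^N} |W_{e₀}|² = N ‖k‖⁴ (1 + 10ε²)/(1 + 2ε²)` — only the DIAGONAL slot pairs survive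
(`∫_cell β φ_ℂ = 0`). [folklore] -/
theorem secondMoment_waveFun (hL : 0 < L) (ε : ℝ) :
    secondMoment (n + 1) L (waveFun n L ε) e0 =
      ((n : ℝ) + 1) * ((2 * Real.pi / L) ^ 2) ^ 2 * ((1 + 10 * ε ^ 2) / (1 + 2 * ε ^ 2)) := by
  unfold secondMoment
  simp_rw [commutatorAmp_waveFun, norm_mul, mul_pow, Complex.norm_real, Real.norm_eq_abs, sq_abs]
  rw [integral_const_mul]
  have hf1 : ∫ x in cell L, waveFactorC L ε x * waveFactorC L ε x = 1 :=
    integral_cell_waveFactorC_mul_self hL ε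
  have hβf : ∫ x in cell L, betaFactor L ε x * waveFactorC L ε x = 0 :=
    integral_cell_betaFactor_mul_waveFactorC hL ε
  have hcont : ∀ j : Fin (n + 1), Continuous fun X : Config (n + 1) =>
      slotFun (waveFactorC L ε) (betaFactor L ε) j X := fun j =>
    continuous_slotFun (continuous_waveFactorC L ε) (continuous_betaFactor L ε) j
  have key : ∫ X in cellN (n + 1) L, ‖∑ j, slotFun (waveFactorC L ε) (betaFactor L ε) j X‖ ^ 2 =
      ((n : ℝ) + 1) * ((1 + 10 * ε ^ 2) / (1 + 2 * ε ^ 2)) := by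
    apply Complex.ofReal_injective
    rw [← integral_complex_ofReal]
    simp_rw [← Complex.normSq_eq_norm_sq]
    simp_rw [Complex.normSq_eq_conj_mul_self]
    simp_rw [map_sum, Finset.sum_mul_sum, conj_slotFun_waveFactorC]
    have hint : ∀ l j : Fin (n + 1), Integrable (fun X : Config (n + 1) =>
        slotFun (waveFactorC L ε) (fun x => conj (betaFactor L ε x)) l X *
          slotFun (waveFactorC L ε) (betaFactor L ε) j X) (volume.restrict (cellN (n + 1) L)) :=
      fun l j => integrableOn_cellN ((continuous_slotFun (continuous_waveFactorC L ε)
        (Complex.continuous_conj.comp (continuous_betaFactor L ε)) l).mul (hcont j)) L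
    rw [integral_finsetSum _ fun l _ => integrable_finsetSum _ fun j _ => hint l j]
    rw [Finset.sum_congr rfl fun l _ => integral_finsetSum _ fun j _ => hint l j]
    simp_rw [integral_slotFun_mul_slotFun hf1]
    have hconjβf : ∫ x in cell L, conj (betaFactor L ε x) * waveFactorC L ε x = 0 := by
      have : ∀ x, conj (betaFactor L ε x) * waveFactorC L ε x =
          conj (betaFactor L ε x * waveFactorC L ε x) := fun x => by
        rw [map_mul, conj_waveFactorC]
      simp_rw [this]
      rw [integral_conj, hβf, map_zero]
    simp only [hconjβf, hβf, mul_zero, Finset.sum_ite_eq, Finset.mem_univ, if_true]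
    rw [integral_cell_conj_betaFactor_mul hL, Finset.sum_const, Finset.card_univ, Fintype.card_fin,
      nsmul_eq_mul]
    push_cast
    ring
  rw [key]
  ring

/-! ### Insertion pairings against the commutator amplitude of the density wave -/

/-- `∫_cell e⁴ = 0` (the plane wave `e_{4e₀}`). [folklore] -/
theorem integral_cell_cellWave_pow_four (hL : 0 < L) {k : Fin 3 → ℤ} (hk : k ≠ 0) :
    ∫ x in cell L, cellWave L k x * cellWave L k x * cellWave L k x * cellWave L k x = 0 := by
  simp_rw [← cellWave_add_index]
  refine integral_cell_cellWave_eq_zero hL ?_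
  intro h
  apply hk
  funext j
  have := congrFun h j
  simp only [Pi.add_apply, Pi.zero_apply] at this
  simp only [Pi.zero_apply]
  omega

/-- `∫_cell conj(e)·conj(e) = 0`. [folklore] -/
theorem integral_cell_conj_cellWave_sq (hL : 0 < L) {k : Fin 3 → ℤ} (hk : k ≠ 0) :
    ∫ x in cell L, conj (cellWave L k x) * conj (cellWave L k x) = 0 := by
  simp_rw [← map_mul]
  rw [integral_conj, integral_cell_cellWave_sq hL hk, map_zero]

/-- `∫_cell ē β φ_ℂ = 1` (the diagonal of the f-sum pairing). [folklore] -/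
theorem integral_cell_conj_cellWave_mul_betaFactor_mul (hL : 0 < L) (ε : ℝ) :
    ∫ x in cell L, conj (cellWave L e0 x) * (betaFactor L ε x * waveFactorC L ε x) = 1 := by
  have h1 : ∀ x, conj (cellWave L e0 x) * (betaFactor L ε x * waveFactorC L ε x) =
      ((cnorm L ε ^ 2 : ℝ) : ℂ) * ((1 + 2 * ε ^ 2) + 4 * ε * cellWave L e0 x
        + 3 * ε ^ 2 * (cellWave L e0 x * cellWave L e0 x)
        - ε ^ 2 * (conj (cellWave L e0 x) * conj (cellWave L e0 x))) := by
    intro x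
    rw [betaFactor_mul_waveFactorC]
    have h := cellWave_mul_conj L e0 x
    linear_combination ((cnorm L ε ^ 2 : ℝ) : ℂ) * ((1 + 2 * (ε : ℂ) ^ 2)
      + 4 * (ε : ℂ) * cellWave L e0 x + 3 * (ε : ℂ) ^ 2 * (cellWave L e0 x * cellWave L e0 x)) * h
  simp_rw [h1]
  rw [integral_const_mul]
  have i0 : Integrable (fun _ : Space => ((1 + 2 * ε ^ 2 : ℝ) : ℂ)) (volume.restrict (cell L)) := by
    haveI := Summit.AtomisticToContinuum.BoseEinsteinCondensation.Theorems.StaticResponseBound.Negative.isFiniteMeasure_restrict_cell L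
    exact integrable_const _
  have ie : Integrable (cellWave L e0) (volume.restrict (cell L)) :=
    integrableOn_cell (continuous_cellWave L e0)
  have ie2 : Integrable (fun x => cellWave L e0 x * cellWave L e0 x) (volume.restrict (cell L)) :=
    integrableOn_cell ((continuous_cellWave L e0).mul (continuous_cellWave L e0))
  have iec2 : Integrable (fun x => conj (cellWave L e0 x) * conj (cellWave L e0 x))
      (volume.restrict (cell L)) :=
    integrableOn_cell ((Complex.continuous_conj.comp (continuous_cellWave L e0)).mul
      (Complex.continuous_conj.comp (continuous_cellWave L e0)))
  have i1 : Integrable (fun x => 4 * (ε : ℂ) * cellWave L e0 x) (volume.restrict (cell L)) :=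
    ie.const_mul _
  have i2 : Integrable (fun x => 3 * (ε : ℂ) ^ 2 * (cellWave L e0 x * cellWave L e0 x))
      (volume.restrict (cell L)) := ie2.const_mul _
  have i3 : Integrable (fun x => (ε : ℂ) ^ 2 * (conj (cellWave L e0 x) * conj (cellWave L e0 x)))
      (volume.restrict (cell L)) := iec2.const_mul _
  push_cast at i0
  have i01 : Integrable (fun x => 1 + 2 * (ε : ℂ) ^ 2 + 4 * (ε : ℂ) * cellWave L e0 x)
      (volume.restrict (cell L)) := i0.add i1
  have i012 : Integrable (fun x => 1 + 2 * (ε : ℂ) ^ 2 + 4 * (ε : ℂ) * cellWave L e0 x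
      + 3 * (ε : ℂ) ^ 2 * (cellWave L e0 x * cellWave L e0 x)) (volume.restrict (cell L)) := i01.add i2
  rw [integral_sub i012 i3, integral_add i01 i2, integral_add i0 i1,
    integral_const_mul, integral_const_mul, integral_const_mul,
    integral_cell_cellWave_eq_zero hL e0_ne_zero, integral_cell_cellWave_sq hL e0_ne_zero,
    integral_cell_conj_cellWave_sq hL e0_ne_zero, setIntegral_const]
  rw [measureReal_def, volume_cell, ← ENNReal.ofReal_pow hL.le, ENNReal.toReal_ofReal (by positivity),
    Complex.real_smul]
  have hc := congrArg (fun r : ℝ => (r : ℂ)) (cnorm_sq_mul hL ε)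
  push_cast at hc ⊢
  linear_combination hc

/-- `∫_cell e β φ_ℂ = −ε²/(1 + 2ε²)` (the diagonal of the `Z`-pairing: `−E[e^{2iθ}]` per particle). [folklore] -/
theorem integral_cell_cellWave_mul_betaFactor_mul (hL : 0 < L) (ε : ℝ) :
    ∫ x in cell L, cellWave L e0 x * (betaFactor L ε x * waveFactorC L ε x) =
      ((-(ε ^ 2 / (1 + 2 * ε ^ 2)) : ℝ) : ℂ) := by
  have h1 : ∀ x, cellWave L e0 x * (betaFactor L ε x * waveFactorC L ε x) =
      ((cnorm L ε ^ 2 : ℝ) : ℂ) * ((1 + 2 * ε ^ 2) * (cellWave L e0 x * cellWave L e0 x)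
        + 4 * ε * (cellWave L e0 x * cellWave L e0 x * cellWave L e0 x)
        + 3 * ε ^ 2 * (cellWave L e0 x * cellWave L e0 x * cellWave L e0 x * cellWave L e0 x)
        - ε ^ 2) := by
    intro x
    rw [betaFactor_mul_waveFactorC]
    have h := cellWave_mul_conj L e0 x
    linear_combination ((cnorm L ε ^ 2 : ℝ) : ℂ) * (-(ε : ℂ) ^ 2) * h
  simp_rw [h1]
  rw [integral_const_mul]
  have ie2 : Integrable (fun x => cellWave L e0 x * cellWave L e0 x) (volume.restrict (cell L)) :=
    integrableOn_cell ((continuous_cellWave L e0).mul (continuous_cellWave L e0))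
  have ie3 : Integrable (fun x => cellWave L e0 x * cellWave L e0 x * cellWave L e0 x)
      (volume.restrict (cell L)) :=
    integrableOn_cell (((continuous_cellWave L e0).mul (continuous_cellWave L e0)).mul
      (continuous_cellWave L e0))
  have ie4 : Integrable (fun x => cellWave L e0 x * cellWave L e0 x * cellWave L e0 x * cellWave L e0 x)
      (volume.restrict (cell L)) :=
    integrableOn_cell ((((continuous_cellWave L e0).mul (continuous_cellWave L e0)).mul
      (continuous_cellWave L e0)).mul (continuous_cellWave L e0))
  have ic : Integrable (fun _ : Space => (ε : ℂ) ^ 2) (volume.restrict (cell L)) := by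
    haveI := Summit.AtomisticToContinuum.BoseEinsteinCondensation.Theorems.StaticResponseBound.Negative.isFiniteMeasure_restrict_cell L
    exact integrable_const _
  have i1 : Integrable (fun x => (1 + 2 * (ε : ℂ) ^ 2) * (cellWave L e0 x * cellWave L e0 x))
      (volume.restrict (cell L)) := ie2.const_mul _
  have i2 : Integrable (fun x => 4 * (ε : ℂ) * (cellWave L e0 x * cellWave L e0 x * cellWave L e0 x))
      (volume.restrict (cell L)) := ie3.const_mul _
  have i3 : Integrable (fun x => 3 * (ε : ℂ) ^ 2 *
      (cellWave L e0 x * cellWave L e0 x * cellWave L e0 x * cellWave L e0 x))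
      (volume.restrict (cell L)) := ie4.const_mul _
  have i12 : Integrable (fun x => (1 + 2 * (ε : ℂ) ^ 2) * (cellWave L e0 x * cellWave L e0 x)
      + 4 * (ε : ℂ) * (cellWave L e0 x * cellWave L e0 x * cellWave L e0 x))
      (volume.restrict (cell L)) := i1.add i2
  have i123 : Integrable (fun x => (1 + 2 * (ε : ℂ) ^ 2) * (cellWave L e0 x * cellWave L e0 x)
      + 4 * (ε : ℂ) * (cellWave L e0 x * cellWave L e0 x * cellWave L e0 x)
      + 3 * (ε : ℂ) ^ 2 * (cellWave L e0 x * cellWave L e0 x * cellWave L e0 x * cellWave L e0 x))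
      (volume.restrict (cell L)) := i12.add i3
  rw [integral_sub i123 ic, integral_add i12 i3, integral_add i1 i2,
    integral_const_mul, integral_const_mul, integral_const_mul,
    integral_cell_cellWave_sq hL e0_ne_zero, integral_cell_cellWave_cube hL e0_ne_zero,
    integral_cell_cellWave_pow_four hL e0_ne_zero, setIntegral_const]
  rw [measureReal_def, volume_cell, ← ENNReal.ofReal_pow hL.le, ENNReal.toReal_ofReal (by positivity),
    Complex.real_smul]
  have hc := congrArg (fun r : ℝ => (r : ℂ)) (cnorm_sq_mul_cube hL ε)
  push_cast at hc ⊢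
  rw [div_eq_mul_inv, ← hc]
  ring

/-- **Insertion pairings against the commutator amplitude of the density wave**: for a
continuous one-body multiplier `q`,
`∫ (∑ₗ q(x_l)) W Ψ̄ = ‖k‖² N ∫_cell q φ_ℂ β` (off-diagonal slot pairs vanish by `∫_cell β φ_ℂ = 0`). [folklore] -/
theorem integral_insertion_mul_commutatorAmp_waveFun (hL : 0 < L) (ε : ℝ) {q : Space → ℂ}
    (hq : Continuous q) :
    ∫ X in cellN (n + 1) L, (∑ l, q (X l)) * commutatorAmp (n + 1) L (waveFun n L ε) e0 X *
        conj (waveFun n L ε X) =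
      (((2 * Real.pi / L) ^ 2 : ℝ) : ℂ) * ((n : ℂ) + 1) *
        ∫ x in cell L, (q x * waveFactorC L ε x) * betaFactor L ε x := by
  have hf1 : ∫ x in cell L, waveFactorC L ε x * waveFactorC L ε x = 1 :=
    integral_cell_waveFactorC_mul_self hL ε
  have hβf : ∫ x in cell L, betaFactor L ε x * waveFactorC L ε x = 0 :=
    integral_cell_betaFactor_mul_waveFactorC hL ε
  have hq' : ∀ (X : Config (n + 1)) (l : Fin (n + 1)), q (X l) * waveFun n L ε X =
      slotFun (waveFactorC L ε) (fun x => q x * waveFactorC L ε x) l X := fun X l => by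
    rw [waveFun_eq_slotFun L ε l X]
    unfold slotFun
    ring
  have hpt : ∀ X : Config (n + 1),
      (∑ l, q (X l)) * commutatorAmp (n + 1) L (waveFun n L ε) e0 X * conj (waveFun n L ε X) =
      (((2 * Real.pi / L) ^ 2 : ℝ) : ℂ) * ∑ l, ∑ j,
        slotFun (waveFactorC L ε) (fun x => q x * waveFactorC L ε x) l X *
          slotFun (waveFactorC L ε) (betaFactor L ε) j X := by
    intro X
    rw [commutatorAmp_waveFun, conj_waveFun]
    have h1 : (∑ l, q (X l)) * ((((2 * Real.pi / L) ^ 2 : ℝ) : ℂ) *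
        ∑ j, slotFun (waveFactorC L ε) (betaFactor L ε) j X) * waveFun n L ε X =
        (((2 * Real.pi / L) ^ 2 : ℝ) : ℂ) * (((∑ l, q (X l)) * waveFun n L ε X) *
          ∑ j, slotFun (waveFactorC L ε) (betaFactor L ε) j X) := by ring
    rw [h1, Finset.sum_mul, Finset.sum_congr rfl fun l _ => hq' X l, Finset.sum_mul_sum]
  simp_rw [hpt]
  rw [integral_const_mul]
  have hint : ∀ l j : Fin (n + 1), Integrable (fun X : Config (n + 1) =>
      slotFun (waveFactorC L ε) (fun x => q x * waveFactorC L ε x) l X *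
        slotFun (waveFactorC L ε) (betaFactor L ε) j X) (volume.restrict (cellN (n + 1) L)) :=
    fun l j => integrableOn_cellN ((continuous_slotFun (continuous_waveFactorC L ε)
      (hq.mul (continuous_waveFactorC L ε)) l).mul (continuous_slotFun (continuous_waveFactorC L ε)
        (continuous_betaFactor L ε) j)) L
  rw [integral_finsetSum _ fun l _ => integrable_finsetSum _ fun j _ => hint l j]
  rw [Finset.sum_congr rfl fun l _ => integral_finsetSum _ fun j _ => hint l j]
  simp_rw [integral_slotFun_mul_slotFun hf1]
  simp only [hβf, mul_zero, Finset.sum_ite_eq, Finset.mem_univ, if_true]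
  rw [Finset.sum_const, Finset.card_univ, Fintype.card_fin, nsmul_eq_mul]
  push_cast
  ring

/-- **`⟨Ψ, [−Δ, Z]Ψ⟩ = 0` on the density wave, slot by slot**: `∫ W Ψ̄ = 0`. [folklore] -/
theorem integral_commutatorAmp_mul_conj_waveFun (hL : 0 < L) (ε : ℝ) :
    ∫ X in cellN (n + 1) L, commutatorAmp (n + 1) L (waveFun n L ε) e0 X * conj (waveFun n L ε X) = 0 := by
  have hf1 : ∫ x in cell L, waveFactorC L ε x * waveFactorC L ε x = 1 :=
    integral_cell_waveFactorC_mul_self hL ε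
  have hβf : ∫ x in cell L, betaFactor L ε x * waveFactorC L ε x = 0 :=
    integral_cell_betaFactor_mul_waveFactorC hL ε
  have hpt : ∀ X : Config (n + 1),
      commutatorAmp (n + 1) L (waveFun n L ε) e0 X * conj (waveFun n L ε X) =
      (((2 * Real.pi / L) ^ 2 : ℝ) : ℂ) * ∑ j,
        slotFun (waveFactorC L ε) (betaFactor L ε) j X *
          slotFun (waveFactorC L ε) (waveFactorC L ε) j X := by
    intro X
    rw [commutatorAmp_waveFun, conj_waveFun, mul_assoc, Finset.sum_mul]
    congr 1
    exact Finset.sum_congr rfl fun j _ => by rw [← waveFun_eq_slotFun L ε j X]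
  simp_rw [hpt]
  rw [integral_const_mul]
  have hint : ∀ j : Fin (n + 1), Integrable (fun X : Config (n + 1) =>
      slotFun (waveFactorC L ε) (betaFactor L ε) j X *
        slotFun (waveFactorC L ε) (waveFactorC L ε) j X) (volume.restrict (cellN (n + 1) L)) :=
    fun j => integrableOn_cellN ((continuous_slotFun (continuous_waveFactorC L ε)
      (continuous_betaFactor L ε) j).mul (continuous_slotFun (continuous_waveFactorC L ε)
        (continuous_waveFactorC L ε) j)) L
  rw [integral_finsetSum _ fun j _ => hint j]
  simp [integral_slotFun_mul_slotFun hf1, hβf]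

/-- **The f-sum pairing on the density wave** (consistency check of `commutatorAmp_waveFun` with
the general f-sum rule): `∫ Z̄ W Ψ̄ = N‖k‖²`. [folklore] -/
theorem integral_conj_densityMode_mul_commutatorAmp_waveFun (hL : 0 < L) (ε : ℝ) :
    ∫ X in cellN (n + 1) L, conj (densityMode (n + 1) L e0 X) *
        commutatorAmp (n + 1) L (waveFun n L ε) e0 X * conj (waveFun n L ε X) =
      (((2 * Real.pi / L) ^ 2 : ℝ) : ℂ) * ((n : ℂ) + 1) := by
  unfold densityMode
  simp_rw [map_sum]
  rw [integral_insertion_mul_commutatorAmp_waveFun hL ε (q := fun x => conj (cellWave L e0 x))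
    (Complex.continuous_conj.comp (continuous_cellWave L e0))]
  have : ∫ x in cell L, conj (cellWave L e0 x) * waveFactorC L ε x * betaFactor L ε x = 1 := by
    have hh : ∀ x, conj (cellWave L e0 x) * waveFactorC L ε x * betaFactor L ε x =
        conj (cellWave L e0 x) * (betaFactor L ε x * waveFactorC L ε x) := fun x => by ring
    simp_rw [hh]
    exact integral_cell_conj_cellWave_mul_betaFactor_mul hL ε
  rw [this, mul_one]

/-- **The `Z`-pairing on the density wave**: `∫ Z W Ψ̄ = −N‖k‖² ε²/(1+2ε²)` (`= −‖k‖² E[Z_{2e₀}]`, as the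
Stein form predicts). [folklore] -/
theorem integral_densityMode_mul_commutatorAmp_waveFun (hL : 0 < L) (ε : ℝ) :
    ∫ X in cellN (n + 1) L, densityMode (n + 1) L e0 X *
        commutatorAmp (n + 1) L (waveFun n L ε) e0 X * conj (waveFun n L ε X) =
      (((2 * Real.pi / L) ^ 2 : ℝ) : ℂ) * ((n : ℂ) + 1) * ((-(ε ^ 2 / (1 + 2 * ε ^ 2)) : ℝ) : ℂ) := by
  unfold densityMode
  rw [integral_insertion_mul_commutatorAmp_waveFun hL ε (continuous_cellWave L e0)]
  have : ∫ x in cell L, cellWave L e0 x * waveFactorC L ε x * betaFactor L ε x =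
      ((-(ε ^ 2 / (1 + 2 * ε ^ 2)) : ℝ) : ℂ) := by
    have hh : ∀ x, cellWave L e0 x * waveFactorC L ε x * betaFactor L ε x =
        cellWave L e0 x * (betaFactor L ε x * waveFactorC L ε x) := fun x => by ring
    simp_rw [hh]
    exact integral_cell_cellWave_mul_betaFactor_mul hL ε
  rw [this]

end WaveCommutator

/-! ### The AM–GM rung: `J^V_m(φ) ≤ 4 m₂/(N² ‖k‖⁴)` for every state and every continuous field -/

section Rung

variable {L : ℝ} {n : ℕ}

/-- Completion of the square: `−2c Re(ū W) − |u|² = c²|W|² − |u + cW|² ≤ c²|W|²`. [folklore] -/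
theorem neg_pairing_sub_norm_sq_le (u W : ℂ) (c : ℝ) :
    -(2 * c) * (conj u * W).re - ‖u‖ ^ 2 ≤ c ^ 2 * ‖W‖ ^ 2 := by
  have h0 : 0 ≤ Complex.normSq (u + (c : ℂ) * W) := Complex.normSq_nonneg _
  rw [Complex.normSq_add, Complex.normSq_eq_norm_sq, Complex.normSq_eq_norm_sq, norm_mul,
    Complex.norm_real, Real.norm_eq_abs, mul_pow, sq_abs] at h0
  have hre : (u * conj ((c : ℂ) * W)).re = c * (conj u * W).re := by
    rw [map_mul, Complex.conj_ofReal, show u * ((c : ℂ) * conj W) = (c : ℂ) * (u * conj W) by ring,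
      Complex.re_ofReal_mul]
    congr 1
    rw [show conj u * W = conj (u * conj W) by rw [map_mul, Complex.conj_conj], Complex.conj_re]
  rw [hre] at h0
  nlinarith [h0]

/-- The commutator amplitude of an admissible (`C¹`) state is continuous. [folklore] -/
theorem continuous_commutatorAmp (Ψ : PeriodicTrialState (n + 1) L) (m : Fin 3 → ℤ) :
    Continuous fun X : Config (n + 1) => commutatorAmp (n + 1) L Ψ.ψ m X := by
  unfold commutatorAmp
  refine continuous_finsetSum _ fun j _ => ?_
  refine ((continuous_cellWave L m).comp (continuous_apply j)).mul ?_
  refine (continuous_const.mul Ψ.contDiff.continuous).sub (continuous_const.mul ?_)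
  exact (Ψ.contDiff.continuous_fderiv one_ne_zero).clm_apply continuous_const

/-- **The AM–GM rung** (data processing along the density-wave lift, no minimality, no density):
for every admissible state, every mode `m ≠ 0` and every continuous test field,
`J^V_m(φ) ≤ 4 m₂ /(N² ‖k‖⁴)`. [folklore] -/
theorem fisherTestV_le_secondMoment (hL : 0 < L) (Ψ : PeriodicTrialState (n + 1) L)
    {m : Fin 3 → ℤ} (hm : m ≠ 0) {φ : ℂ → ℂ} (hφ : Continuous φ) :
    fisherTestV n L Ψ m φ ≤
      4 * secondMoment (n + 1) L Ψ.ψ m / (((n : ℝ) + 1) ^ 2 * ‖waveVec L m‖ ^ 4) := by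
  rw [show ‖waveVec L m‖ ^ 4 = (‖waveVec L m‖ ^ 2) ^ 2 by ring]
  unfold fisherTestV secondMoment
  have hK : 0 < ‖waveVec L m‖ ^ 2 := pow_pos (norm_waveVec_pos hL hm) 2
  have hN : (0 : ℝ) < (n : ℝ) + 1 := by positivity
  set K : ℝ := ‖waveVec L m‖ ^ 2 with hKdef
  set N : ℝ := (n : ℝ) + 1 with hNdef
  set c : ℝ := 2 / (N * K) with hcdef
  have hZ : Continuous fun X : Config (n + 1) => densityMode (n + 1) L m X := by
    unfold densityMode; fun_prop
  have hW := continuous_commutatorAmp Ψ m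
  have hψ : Continuous Ψ.ψ := Ψ.contDiff.continuous
  set a : Config (n + 1) → ℝ := fun X => (conj (φ (densityMode (n + 1) L m X)) *
    commutatorAmp (n + 1) L Ψ.ψ m X * conj (Ψ.ψ X)).re with hadef
  set b : Config (n + 1) → ℝ := fun X => ‖φ (densityMode (n + 1) L m X)‖ ^ 2 * ‖Ψ.ψ X‖ ^ 2
    with hbdef
  have ia : Integrable a (volume.restrict (cellN (n + 1) L)) :=
    integrableOn_cellN (Complex.continuous_re.comp ((((Complex.continuous_conj.comp (hφ.comp hZ)).mul
      hW).mul (Complex.continuous_conj.comp hψ)))) L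
  have ib : Integrable b (volume.restrict (cellN (n + 1) L)) :=
    integrableOn_cellN ((((hφ.comp hZ).norm).pow 2).mul ((hψ.norm).pow 2)) L
  have iw : Integrable (fun X => c ^ 2 * ‖commutatorAmp (n + 1) L Ψ.ψ m X‖ ^ 2)
      (volume.restrict (cellN (n + 1) L)) :=
    (integrableOn_cellN ((hW.norm).pow 2) L).const_mul _
  have hpt : ∀ X, -(2 * c) * a X - b X ≤ c ^ 2 * ‖commutatorAmp (n + 1) L Ψ.ψ m X‖ ^ 2 := by
    intro X
    have h := neg_pairing_sub_norm_sq_le (φ (densityMode (n + 1) L m X) * Ψ.ψ X)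
      (commutatorAmp (n + 1) L Ψ.ψ m X) c
    have e1 : conj (φ (densityMode (n + 1) L m X) * Ψ.ψ X) * commutatorAmp (n + 1) L Ψ.ψ m X =
        conj (φ (densityMode (n + 1) L m X)) * commutatorAmp (n + 1) L Ψ.ψ m X * conj (Ψ.ψ X) := by
      rw [map_mul]; ring
    rw [e1, norm_mul, mul_pow] at h
    exact h
  have h4 : -(4 / (N * K)) = -(2 * c) := by rw [hcdef]; ring
  calc -(4 / (N * K)) * (∫ X in cellN (n + 1) L, a X) - ∫ X in cellN (n + 1) L, b X
      = ∫ X in cellN (n + 1) L, (-(2 * c) * a X - b X) := by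
        rw [integral_sub (ia.const_mul _) ib, integral_const_mul, h4]
    _ ≤ ∫ X in cellN (n + 1) L, c ^ 2 * ‖commutatorAmp (n + 1) L Ψ.ψ m X‖ ^ 2 :=
        integral_mono ((ia.const_mul _).sub ib) iw hpt
    _ = 4 * (∫ X in cellN (n + 1) L, ‖commutatorAmp (n + 1) L Ψ.ψ m X‖ ^ 2) / (N ^ 2 * K ^ 2) := by
        rw [integral_const_mul, hcdef]
        field_simp
        ring

end Rung


/-! ### The two weakened frames -/

section Frames

/-- The crux frame with the minimiser hypothesis WEAKENED to `periodicEnergy v Ψ ≤ E₀^per + δ` for a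
slack `δ > 0` chosen after `ρ` (and `v`, `C`) but BEFORE `N` — everything else verbatim from
`CruxFrame`. -/
def FrameNearMinimisers
    (P : ℝ → ∀ (ρ : ℝ) (n : ℕ), PeriodicTrialState (n + 1) (sideLength ρ (n + 1)) → Prop) : Prop :=
  ∀ v : ℝ → ℝ≥0∞, IsRepulsiveFiniteRange v → (∀ r, v r ≠ ⊤) →
    ContDiff ℝ 2 (fun x : Space => (v ‖x‖).toReal) →
    (∃ Cₑ : ℝ, ∀ x : Space,
      ‖iteratedFDeriv ℝ 2 (fun x : Space => (v ‖x‖).toReal) x‖ ≤ Cₑ * Real.sqrt ((v ‖x‖).toReal)) →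
    ∃ C : ℝ, 0 ≤ C ∧ ∃ ρ₀ : ℝ, 0 < ρ₀ ∧ ∀ ρ : ℝ, 0 < ρ → ρ < ρ₀ → ∃ δ : ℝ, 0 < δ ∧
      ∀ᶠ n : ℕ in atTop, ∀ Ψ : PeriodicTrialState (n + 1) (sideLength ρ (n + 1)),
        periodicEnergy v Ψ ≤ periodicGroundStateEnergy v (n + 1) (sideLength ρ (n + 1)) +
            ENNReal.ofReal δ →
        periodicEnergy v Ψ ≠ ⊤ → (∀ X, Ψ.ψ X = (‖Ψ.ψ X‖ : ℂ)) → (∀ X, Ψ.ψ X ≠ 0) → P C ρ n Ψ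

/-- The crux frame with the minimiser hypothesis DELETED (finite energy, `Ψ = |Ψ| ≠ 0` kept). -/
def FrameWithoutMinimality
    (P : ℝ → ∀ (ρ : ℝ) (n : ℕ), PeriodicTrialState (n + 1) (sideLength ρ (n + 1)) → Prop) : Prop :=
  ∀ v : ℝ → ℝ≥0∞, IsRepulsiveFiniteRange v → (∀ r, v r ≠ ⊤) →
    ContDiff ℝ 2 (fun x : Space => (v ‖x‖).toReal) →
    (∃ Cₑ : ℝ, ∀ x : Space,
      ‖iteratedFDeriv ℝ 2 (fun x : Space => (v ‖x‖).toReal) x‖ ≤ Cₑ * Real.sqrt ((v ‖x‖).toReal)) →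
    ∃ C : ℝ, 0 ≤ C ∧ ∃ ρ₀ : ℝ, 0 < ρ₀ ∧ ∀ ρ : ℝ, 0 < ρ → ρ < ρ₀ →
      ∀ᶠ n : ℕ in atTop, ∀ Ψ : PeriodicTrialState (n + 1) (sideLength ρ (n + 1)),
        periodicEnergy v Ψ ≠ ⊤ → (∀ X, Ψ.ψ X = (‖Ψ.ψ X‖ : ℂ)) → (∀ X, Ψ.ψ X ≠ 0) → P C ρ n Ψ

variable {P : ℝ → ∀ (ρ : ℝ) (n : ℕ), PeriodicTrialState (n + 1) (sideLength ρ (n + 1)) → Prop}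

/-- The near-minimiser frame is a STRENGTHENING of the crux frame (a minimiser is a
`δ`-near-minimiser). [folklore] -/
theorem cruxFrame_of_frameNear (h : FrameNearMinimisers P) : CruxFrame P := by
  intro v h₁ h₂ h₃ h₄
  obtain ⟨C, hC, ρ₀, hρ₀, hB⟩ := h v h₁ h₂ h₃ h₄
  refine ⟨C, hC, ρ₀, hρ₀, fun ρ hρ hρρ₀ => ?_⟩
  obtain ⟨δ, _hδ, hev⟩ := hB ρ hρ hρρ₀
  filter_upwards [hev] with n hn Ψ hE hfin hreal hpos
  exact hn Ψ (le_of_eq_of_le hE le_self_add) hfin hreal hpos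

/-- The minimality-free frame implies the near-minimiser frame. [folklore] -/
theorem frameNear_of_frameWithout (h : FrameWithoutMinimality P) : FrameNearMinimisers P := by
  intro v h₁ h₂ h₃ h₄
  obtain ⟨C, hC, ρ₀, hρ₀, hB⟩ := h v h₁ h₂ h₃ h₄
  refine ⟨C, hC, ρ₀, hρ₀, fun ρ hρ hρρ₀ => ⟨1, one_pos, ?_⟩⟩
  filter_upwards [hB ρ hρ hρρ₀] with n hn Ψ _hE hfin hreal hpos
  exact hn Ψ hfin hreal hpos

/-- **A free-gas witness family kills the near-minimiser frame.**  If at `v ≡ 0`, for every `ρ > 0`,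
`δ > 0` and `C ≥ 0`, eventually in `N` there is a positive real admissible `Ψ` of energy `≤ δ`
violating `P C ρ n Ψ`, then `FrameNearMinimisers P` is false. [folklore] -/
theorem not_frameNear_of_free_witness
    (hW : ∀ ρ : ℝ, 0 < ρ → ∀ δ : ℝ, 0 < δ → ∀ C : ℝ, 0 ≤ C → ∀ᶠ n : ℕ in atTop,
      ∃ Ψ : PeriodicTrialState (n + 1) (sideLength ρ (n + 1)),
        periodicEnergy 0 Ψ ≤ ENNReal.ofReal δ ∧ (∀ X, Ψ.ψ X = (‖Ψ.ψ X‖ : ℂ)) ∧ (∀ X, Ψ.ψ X ≠ 0) ∧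
          ¬ P C ρ n Ψ) :
    ¬ FrameNearMinimisers P := by
  intro h
  obtain ⟨h₁, h₂, h₃, h₄⟩ := inSmoothClass_zero
  obtain ⟨C, hC, ρ₀, hρ₀, hB⟩ := h 0 h₁ h₂ h₃ h₄
  have hρ : (0 : ℝ) < ρ₀ / 2 := by positivity
  obtain ⟨δ, hδ, hev⟩ := hB (ρ₀ / 2) hρ (by linarith)
  obtain ⟨n, hn, Ψ, hEδ, hreal, hpos, hP⟩ := (hev.and (hW (ρ₀ / 2) hρ δ hδ C hC)).exists
  have hfin : periodicEnergy 0 Ψ ≠ ⊤ := ne_top_of_le_ne_top ENNReal.ofReal_ne_top hEδ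
  exact hP (hn Ψ (hEδ.trans le_add_self) hfin hreal hpos)

/-- Corollary for the minimality-free frame. [folklore] -/
theorem not_frameWithout_of_free_witness
    (hW : ∀ ρ : ℝ, 0 < ρ → ∀ δ : ℝ, 0 < δ → ∀ C : ℝ, 0 ≤ C → ∀ᶠ n : ℕ in atTop,
      ∃ Ψ : PeriodicTrialState (n + 1) (sideLength ρ (n + 1)),
        periodicEnergy 0 Ψ ≤ ENNReal.ofReal δ ∧ (∀ X, Ψ.ψ X = (‖Ψ.ψ X‖ : ℂ)) ∧ (∀ X, Ψ.ψ X ≠ 0) ∧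
          ¬ P C ρ n Ψ) :
    ¬ FrameWithoutMinimality P := fun h =>
  not_frameNear_of_free_witness hW (frameNear_of_frameWithout h)

end Frames

/-! ### The four rung bodies (verbatim the lambda bodies of the Defs statements) -/

section Bodies

/-- DMD body: `4 N² ‖k‖⁴ ν_m ≤ C · m₂` for all `m ≠ 0`. -/
def dmdBody (C ρ : ℝ) (n : ℕ) (Ψ : PeriodicTrialState (n + 1) (sideLength ρ (n + 1))) : Prop :=
  ∀ m : Fin 3 → ℤ, m ≠ 0 →
    4 * ((n : ℝ) + 1) ^ 2 * ‖waveVec (sideLength ρ (n + 1)) m‖ ^ 4 *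
        levyWeight n (sideLength ρ (n + 1)) Ψ m ≤
      C * secondMoment (n + 1) (sideLength ρ (n + 1)) Ψ.ψ m

/-- FS body: `(N S_m) · m₂ ≤ C · N² ‖k‖⁴` for all `m ≠ 0`. -/
def fsBody (C ρ : ℝ) (n : ℕ) (Ψ : PeriodicTrialState (n + 1) (sideLength ρ (n + 1))) : Prop :=
  ∀ m : Fin 3 → ℤ, m ≠ 0 →
    (((n : ℝ) + 1) * structureFactor n (sideLength ρ (n + 1)) Ψ m) *
        secondMoment (n + 1) (sideLength ρ (n + 1)) Ψ.ψ m ≤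
      C * (((n : ℝ) + 1) ^ 2 * ‖waveVec (sideLength ρ (n + 1)) m‖ ^ 4)

/-- FD-V body: `∃ φ continuous, 16 ν_m ≤ C · J^V_m(φ)` for all `m ≠ 0`. -/
def fdVBody (C ρ : ℝ) (n : ℕ) (Ψ : PeriodicTrialState (n + 1) (sideLength ρ (n + 1))) : Prop :=
  ∀ m : Fin 3 → ℤ, m ≠ 0 → ∃ φ : ℂ → ℂ, Continuous φ ∧
    16 * levyWeight n (sideLength ρ (n + 1)) Ψ m ≤ C * fisherTestV n (sideLength ρ (n + 1)) Ψ m φ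

/-- FG-V body: `∀ φ continuous, J^V_m(φ) · (N S_m) ≤ C` for all `m ≠ 0`. -/
def fgVBody (C ρ : ℝ) (n : ℕ) (Ψ : PeriodicTrialState (n + 1) (sideLength ρ (n + 1))) : Prop :=
  ∀ m : Fin 3 → ℤ, m ≠ 0 → ∀ φ : ℂ → ℂ, Continuous φ →
    fisherTestV n (sideLength ρ (n + 1)) Ψ m φ *
      (((n : ℝ) + 1) * structureFactor n (sideLength ρ (n + 1)) Ψ m) ≤ C

/-- Certificate: `DensityMomentDomination` IS `CruxFrame dmdBody`. -/
theorem densityMomentDomination_iff : DensityMomentDomination ↔ CruxFrame dmdBody := Iff.rfl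

/-- Certificate: `FeynmanSaturation` IS `CruxFrame fsBody`. -/
theorem feynmanSaturation_iff : FeynmanSaturation ↔ CruxFrame fsBody := Iff.rfl

/-- Certificate: `FisherDominationV` IS `CruxFrame fdVBody`. -/
theorem fisherDominationV_iff : FisherDominationV ↔ CruxFrame fdVBody := Iff.rfl

/-- Certificate: `FisherGaussianityV` IS `CruxFrame fgVBody`. -/
theorem fisherGaussianityV_iff : FisherGaussianityV ↔ CruxFrame fgVBody := Iff.rfl

/-- DMD with minimality weakened to `δ`-near-minimality (`δ` before `N`). -/
def DensityMomentDominationNearMinimisers : Prop := FrameNearMinimisers dmdBody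
/-- DMD with the minimiser hypothesis deleted. -/
def DensityMomentDominationWithoutMinimality : Prop := FrameWithoutMinimality dmdBody
/-- FS with minimality weakened to `δ`-near-minimality. -/
def FeynmanSaturationNearMinimisers : Prop := FrameNearMinimisers fsBody
/-- FS with the minimiser hypothesis deleted. -/
def FeynmanSaturationWithoutMinimality : Prop := FrameWithoutMinimality fsBody
/-- FD-V with minimality weakened to `δ`-near-minimality. -/
def FisherDominationVNearMinimisers : Prop := FrameNearMinimisers fdVBody
/-- FD-V with the minimiser hypothesis deleted. -/
def FisherDominationVWithoutMinimality : Prop := FrameWithoutMinimality fdVBody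
/-- FG-V with minimality weakened to `δ`-near-minimality. -/
def FisherGaussianityVNearMinimisers : Prop := FrameNearMinimisers fgVBody
/-- FG-V with the minimiser hypothesis deleted. -/
def FisherGaussianityVWithoutMinimality : Prop := FrameWithoutMinimality fgVBody

end Bodies

/-! ### Growth of the witness scale `T_N = min(N/16, δL²/(16π²))` -/

section Growth

/-- `T_N := min(N/16, δ L_N²/(16π²)) → ∞`: for every `a > 0` and `C`, eventually `C < a · T_N`
(`L_N³ = N/ρ`). [folklore] -/
theorem eventually_lt_mul_witnessScale {ρ : ℝ} (hρ : 0 < ρ) {δ : ℝ} (hδ : 0 < δ) {a : ℝ} (ha : 0 < a)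
    (C : ℝ) :
    ∀ᶠ n : ℕ in atTop, C < a * min (((n : ℝ) + 1) / 16)
      (δ * sideLength ρ (n + 1) ^ 2 / (16 * Real.pi ^ 2)) := by
  set C' : ℝ := max C 0 + 1 with hC'
  have hC'0 : 0 < C' := by have := le_max_right C 0; rw [hC']; linarith
  have hCC' : C < C' := by have := le_max_left C 0; rw [hC']; linarith
  set M : ℝ := max 1 (16 * Real.pi ^ 2 * C' / (a * δ)) with hM
  have hM1 : 1 ≤ M := le_max_left _ _
  have h1 : ∀ᶠ n : ℕ in atTop, 16 * C' / a < (n : ℝ) :=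
    tendsto_natCast_atTop_atTop.eventually_gt_atTop _
  have h2 : ∀ᶠ n : ℕ in atTop, ρ * M ^ 3 < (n : ℝ) :=
    tendsto_natCast_atTop_atTop.eventually_gt_atTop _
  filter_upwards [h1, h2] with n hn1 hn2
  have hL3 := sideLength_succ_pow_three hρ n
  set L := sideLength ρ (n + 1) with hLdef
  have hL : 0 < L := sideLength_succ_pos hρ n
  have hLM : M < L := by
    refine lt_of_pow_lt_pow_left₀ 3 hL.le ?_
    rw [hL3, lt_div_iff₀ hρ]
    have hM0 : 0 ≤ M ^ 3 := by positivity
    nlinarith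
  have hL1 : 1 ≤ L := hM1.trans hLM.le
  refine hCC'.trans_le ?_
  rw [mul_min_of_nonneg _ _ ha.le]
  refine le_min ?_ ?_
  · rw [div_lt_iff₀ ha] at hn1
    have : (n : ℝ) ≤ (n : ℝ) + 1 := by linarith
    nlinarith
  · have hKM : 16 * Real.pi ^ 2 * C' / (a * δ) ≤ M := le_max_right _ _
    rw [div_le_iff₀ (by positivity)] at hKM
    have hLL : L ≤ L ^ 2 := by nlinarith
    have hpi : 0 < 16 * Real.pi ^ 2 := by positivity
    rw [mul_div_assoc', le_div_iff₀ hpi]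
    calc C' * (16 * Real.pi ^ 2) = 16 * Real.pi ^ 2 * C' := by ring
      _ ≤ M * (a * δ) := hKM
      _ ≤ L * (a * δ) := by nlinarith [hLM.le, mul_pos ha hδ]
      _ ≤ L ^ 2 * (a * δ) := by nlinarith [mul_pos ha hδ]
      _ = a * (δ * L ^ 2) := by ring

end Growth

/-! ### The witness: the free density wave of slack `δ` against the four rungs -/

section Witness

variable {n : ℕ}

/-- `N · min(1/16, δL²/(16π²N)) = min(N/16, δL²/(16π²))`. [folklore] -/
theorem succ_mul_min_eq (n : ℕ) (δ L : ℝ) :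
    ((n : ℝ) + 1) * min (1 / 16) (δ * L ^ 2 / (16 * Real.pi ^ 2 * ((n : ℝ) + 1))) =
      min (((n : ℝ) + 1) / 16) (δ * L ^ 2 / (16 * Real.pi ^ 2)) := by
  have hN : (0 : ℝ) < (n : ℝ) + 1 := by positivity
  rw [mul_min_of_nonneg _ _ hN.le]
  congr 1
  · ring
  · field_simp

/-- **The lifted Fisher functional of the density wave at the centred affine field**:
`J^V(φ_{1/N,μ_N}) ≥ (8/9)/N` for `ε² ≤ 1/16` (pairing `2λ(1 − ε²/(1+2ε²))` from the `Z`/`Z̄`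
pairings and `∫WΨ̄ = 0`, minus `λ² Var(Re Z) ≤ λ² N`, at `λ = 1/N`). [folklore] -/
theorem fisherTestV_affineField_waveState_ge {L : ℝ} (hL : 0 < L) {ε : ℝ} (hε : |ε| < 1 / 2)
    (hε16 : ε ^ 2 ≤ 1 / 16) :
    (8 / 9) / ((n : ℝ) + 1) ≤
      fisherTestV n L (waveState n hL ε) e0 (affineField ((n : ℝ) + 1)⁻¹ (waveMean n ε)) := by
  unfold fisherTestV
  simp only [waveState_ψ]
  have hN : (0 : ℝ) < (n : ℝ) + 1 := by positivity
  set lam : ℝ := ((n : ℝ) + 1)⁻¹ with hlam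
  set μ : ℝ := waveMean n ε with hμ
  set K : ℝ := (2 * Real.pi / L) ^ 2 with hKdef
  have hK0 : 0 < K := by positivity
  have hKw : ‖waveVec L e0‖ ^ 2 = K := norm_waveVec_e0_sq L
  rw [hKw]
  set s' : ℝ := ε ^ 2 / (1 + 2 * ε ^ 2) with hs'
  have hs'le : s' ≤ 1 / 18 := by
    rw [hs', div_le_iff₀ (by positivity)]; linarith
  -- continuity / integrability
  have hZ : Continuous fun X : Config (n + 1) => densityMode (n + 1) L e0 X := by
    unfold densityMode; fun_prop
  have hW : Continuous fun X : Config (n + 1) => commutatorAmp (n + 1) L (waveFun n L ε) e0 X := by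
    have h := continuous_commutatorAmp (waveState n hL ε) e0
    simpa only [waveState_ψ] using h
  have hψ : Continuous (waveFun n L ε) := (contDiff_prodFun fun _ => contDiff_waveFactorC L ε).continuous
  have hWΨ : Continuous fun X : Config (n + 1) =>
      commutatorAmp (n + 1) L (waveFun n L ε) e0 X * conj (waveFun n L ε X) :=
    hW.mul (Complex.continuous_conj.comp hψ)
  have i1 : Integrable (fun X : Config (n + 1) => densityMode (n + 1) L e0 X *
      commutatorAmp (n + 1) L (waveFun n L ε) e0 X * conj (waveFun n L ε X))
      (volume.restrict (cellN (n + 1) L)) := by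
    have : Continuous fun X : Config (n + 1) => densityMode (n + 1) L e0 X *
        commutatorAmp (n + 1) L (waveFun n L ε) e0 X * conj (waveFun n L ε X) := by
      simp_rw [mul_assoc]; exact hZ.mul hWΨ
    exact integrableOn_cellN this L
  have i2 : Integrable (fun X : Config (n + 1) => conj (densityMode (n + 1) L e0 X) *
      commutatorAmp (n + 1) L (waveFun n L ε) e0 X * conj (waveFun n L ε X))
      (volume.restrict (cellN (n + 1) L)) := by
    have : Continuous fun X : Config (n + 1) => conj (densityMode (n + 1) L e0 X) *
        commutatorAmp (n + 1) L (waveFun n L ε) e0 X * conj (waveFun n L ε X) := by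
      simp_rw [mul_assoc]; exact (Complex.continuous_conj.comp hZ).mul hWΨ
    exact integrableOn_cellN this L
  have i3 : Integrable (fun X : Config (n + 1) =>
      commutatorAmp (n + 1) L (waveFun n L ε) e0 X * conj (waveFun n L ε X))
      (volume.restrict (cellN (n + 1) L)) := integrableOn_cellN hWΨ L
  have hφc : Continuous (affineField lam μ) := (contDiff_affineField lam μ).continuous
  have hint : Integrable (fun X : Config (n + 1) =>
      conj (affineField lam μ (densityMode (n + 1) L e0 X)) *
        commutatorAmp (n + 1) L (waveFun n L ε) e0 X * conj (waveFun n L ε X))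
      (volume.restrict (cellN (n + 1) L)) := by
    have : Continuous fun X : Config (n + 1) => conj (affineField lam μ (densityMode (n + 1) L e0 X)) *
        commutatorAmp (n + 1) L (waveFun n L ε) e0 X * conj (waveFun n L ε X) := by
      simp_rw [mul_assoc]; exact (Complex.continuous_conj.comp (hφc.comp hZ)).mul hWΨ
    exact integrableOn_cellN this L
  -- pointwise decomposition of the complex pairing integrand
  have hpt : ∀ X : Config (n + 1),
      conj (affineField lam μ (densityMode (n + 1) L e0 X)) *
        commutatorAmp (n + 1) L (waveFun n L ε) e0 X * conj (waveFun n L ε X) =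
      (-(lam : ℂ) / 2) * (densityMode (n + 1) L e0 X *
          commutatorAmp (n + 1) L (waveFun n L ε) e0 X * conj (waveFun n L ε X))
      + (-(lam : ℂ) / 2) * (conj (densityMode (n + 1) L e0 X) *
          commutatorAmp (n + 1) L (waveFun n L ε) e0 X * conj (waveFun n L ε X))
      + ((lam * μ : ℝ) : ℂ) * (commutatorAmp (n + 1) L (waveFun n L ε) e0 X * conj (waveFun n L ε X)) := by
    intro X
    have hre : (((densityMode (n + 1) L e0 X).re : ℝ) : ℂ) =
        (densityMode (n + 1) L e0 X + conj (densityMode (n + 1) L e0 X)) / 2 := by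
      rw [Complex.add_conj]; push_cast; ring
    rw [affineField, Complex.conj_ofReal]
    push_cast
    rw [hre]
    ring
  have I1 := integral_densityMode_mul_commutatorAmp_waveFun (n := n) hL ε
  have I2 := integral_conj_densityMode_mul_commutatorAmp_waveFun (n := n) hL ε
  have I3 := integral_commutatorAmp_mul_conj_waveFun (n := n) hL ε
  set r : ℝ := (-lam / 2) * K * ((n : ℝ) + 1) * (1 - s') with hr
  have hcplx : ∫ X in cellN (n + 1) L, conj (affineField lam μ (densityMode (n + 1) L e0 X)) *
      commutatorAmp (n + 1) L (waveFun n L ε) e0 X * conj (waveFun n L ε X) = (r : ℂ) := by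
    simp_rw [hpt]
    have j1 : Integrable (fun X : Config (n + 1) => (-(lam : ℂ) / 2) * (densityMode (n + 1) L e0 X *
        commutatorAmp (n + 1) L (waveFun n L ε) e0 X * conj (waveFun n L ε X)))
        (volume.restrict (cellN (n + 1) L)) := i1.const_mul _
    have j2 : Integrable (fun X : Config (n + 1) => (-(lam : ℂ) / 2) * (conj (densityMode (n + 1) L e0 X) *
        commutatorAmp (n + 1) L (waveFun n L ε) e0 X * conj (waveFun n L ε X)))
        (volume.restrict (cellN (n + 1) L)) := i2.const_mul _
    have j3 : Integrable (fun X : Config (n + 1) => ((lam * μ : ℝ) : ℂ) *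
        (commutatorAmp (n + 1) L (waveFun n L ε) e0 X * conj (waveFun n L ε X)))
        (volume.restrict (cellN (n + 1) L)) := i3.const_mul _
    have j12 : Integrable (fun X : Config (n + 1) => (-(lam : ℂ) / 2) * (densityMode (n + 1) L e0 X *
        commutatorAmp (n + 1) L (waveFun n L ε) e0 X * conj (waveFun n L ε X))
        + (-(lam : ℂ) / 2) * (conj (densityMode (n + 1) L e0 X) *
        commutatorAmp (n + 1) L (waveFun n L ε) e0 X * conj (waveFun n L ε X)))
        (volume.restrict (cellN (n + 1) L)) := j1.add j2
    rw [integral_add j12 j3, integral_add j1 j2, integral_const_mul, integral_const_mul,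
      integral_const_mul, I1, I2, I3, hr, hs', hKdef]
    push_cast
    ring
  have hreal : ∫ X in cellN (n + 1) L, (conj (affineField lam μ (densityMode (n + 1) L e0 X)) *
      commutatorAmp (n + 1) L (waveFun n L ε) e0 X * conj (waveFun n L ε X)).re = r := by
    have h := integral_re hint
    simp only [RCLike.re_to_complex] at h
    rw [h, hcplx, Complex.ofReal_re]
  -- the quadratic term
  have h2 : ∀ X : Config (n + 1), ‖affineField lam μ (densityMode (n + 1) L e0 X)‖ ^ 2 *
      ‖waveFun n L ε X‖ ^ 2 =
      lam ^ 2 * (((densityMode (n + 1) L e0 X).re - μ) ^ 2 * ‖waveFun n L ε X‖ ^ 2) := by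
    intro X
    rw [affineField, Complex.norm_real, Real.norm_eq_abs, sq_abs]
    ring
  have hV := variance_re_densityMode_waveState_le (n := n) hL hε
  rw [hreal]
  simp_rw [h2]
  rw [integral_const_mul]
  have hV0 : 0 ≤ ∫ X in cellN (n + 1) L, ((densityMode (n + 1) L e0 X).re - waveMean n ε) ^ 2 *
      ‖waveFun n L ε X‖ ^ 2 := integral_nonneg fun X => by positivity
  -- arithmetic: J = 2 lam (1 - s') - lam² V ≥ (1 - 2 s')/N ≥ (8/9)/N
  have hfirst : -(4 / (((n : ℝ) + 1) * K)) * r = 2 * lam * (1 - s') := by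
    rw [hr]; field_simp; ring
  rw [hfirst, hlam]
  have hVle : ((n : ℝ) + 1)⁻¹ ^ 2 * ∫ X in cellN (n + 1) L,
      ((densityMode (n + 1) L e0 X).re - μ) ^ 2 * ‖waveFun n L ε X‖ ^ 2 ≤ ((n : ℝ) + 1)⁻¹ := by
    calc ((n : ℝ) + 1)⁻¹ ^ 2 * ∫ X in cellN (n + 1) L,
          ((densityMode (n + 1) L e0 X).re - μ) ^ 2 * ‖waveFun n L ε X‖ ^ 2
        ≤ ((n : ℝ) + 1)⁻¹ ^ 2 * ((n : ℝ) + 1) := mul_le_mul_of_nonneg_left hV (by positivity)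
      _ = ((n : ℝ) + 1)⁻¹ := by field_simp
  have hs'0 : 0 ≤ s' := by positivity
  rw [div_eq_mul_inv, show (8 / 9 : ℝ) * ((n : ℝ) + 1)⁻¹ =
    2 * ((n : ℝ) + 1)⁻¹ * (1 - 1 / 18) - ((n : ℝ) + 1)⁻¹ by ring]
  have hinv : 0 ≤ ((n : ℝ) + 1)⁻¹ := by positivity
  nlinarith [mul_le_mul_of_nonneg_left hs'le hinv, hVle]

/-- **THE LADDER WITNESS.**  Free gas, any `ρ > 0`, any `N = n+1`, any slack `δ > 0`: the density
wave of amplitude `ε² = min(1/16, δL²/(16π²N))` (`L = (N/ρ)^{1/3}`) is a positive real admissible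
state with `periodicEnergy 0 Ψ ≤ δ` and, at the mode `e₀` (`‖k‖² = (2π/L)²`,
`T := min(N/16, δL²/(16π²))`):  `N ν ≥ (7/8) T`, `S ≥ 3 T`, `N‖k‖⁴ ≤ m₂ ≤ 2N‖k‖⁴`,
`J^V(φ) ≤ 8/N` for every continuous `φ`, and `J^V(φ_{1/N,μ_N}) ≥ (8/9)/N`. [folklore] -/
theorem ladder_free_near_minimiser_witness {ρ : ℝ} (hρ : 0 < ρ) (n : ℕ) {δ : ℝ} (hδ : 0 < δ) :
    ∃ Ψ : PeriodicTrialState (n + 1) (sideLength ρ (n + 1)),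
      periodicEnergy 0 Ψ ≤ ENNReal.ofReal δ ∧ (∀ X, Ψ.ψ X = (‖Ψ.ψ X‖ : ℂ)) ∧ (∀ X, Ψ.ψ X ≠ 0) ∧
      (7 / 8) * min (((n : ℝ) + 1) / 16) (δ * sideLength ρ (n + 1) ^ 2 / (16 * Real.pi ^ 2)) ≤
          ((n : ℝ) + 1) * levyWeight n (sideLength ρ (n + 1)) Ψ e0 ∧
      3 * min (((n : ℝ) + 1) / 16) (δ * sideLength ρ (n + 1) ^ 2 / (16 * Real.pi ^ 2)) ≤
          structureFactor n (sideLength ρ (n + 1)) Ψ e0 ∧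
      ((n : ℝ) + 1) * ‖waveVec (sideLength ρ (n + 1)) e0‖ ^ 4 ≤
          secondMoment (n + 1) (sideLength ρ (n + 1)) Ψ.ψ e0 ∧
      secondMoment (n + 1) (sideLength ρ (n + 1)) Ψ.ψ e0 ≤
          2 * ((n : ℝ) + 1) * ‖waveVec (sideLength ρ (n + 1)) e0‖ ^ 4 ∧
      (∀ φ : ℂ → ℂ, Continuous φ →
          fisherTestV n (sideLength ρ (n + 1)) Ψ e0 φ ≤ 8 / ((n : ℝ) + 1)) ∧
      (∃ φ : ℂ → ℂ, Continuous φ ∧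
          (8 / 9) / ((n : ℝ) + 1) ≤ fisherTestV n (sideLength ρ (n + 1)) Ψ e0 φ) := by
  set L := sideLength ρ (n + 1) with hLdef
  have hL : 0 < L := sideLength_succ_pos hρ n
  have hN : (0 : ℝ) < (n : ℝ) + 1 := by positivity
  set s : ℝ := min (1 / 16) (δ * L ^ 2 / (16 * Real.pi ^ 2 * ((n : ℝ) + 1))) with hs
  have hs0 : 0 < s := lt_min (by norm_num) (by positivity)
  have hs16 : s ≤ 1 / 16 := min_le_left _ _
  set ε : ℝ := Real.sqrt s with hεdef
  have hε2 : ε ^ 2 = s := Real.sq_sqrt hs0.le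
  have hεpos : 0 < ε := Real.sqrt_pos.mpr hs0
  have hε : |ε| < 1 / 2 := by
    rw [abs_of_pos hεpos]
    have : ε ≤ Real.sqrt (1 / 16) := Real.sqrt_le_sqrt hs16
    rw [show (1 / 16 : ℝ) = (1 / 4) ^ 2 by norm_num, Real.sqrt_sq (by norm_num)] at this
    linarith
  have hT : ((n : ℝ) + 1) * s = min (((n : ℝ) + 1) / 16) (δ * L ^ 2 / (16 * Real.pi ^ 2)) :=
    succ_mul_min_eq n δ L
  have hK : ‖waveVec L e0‖ ^ 4 = ((2 * Real.pi / L) ^ 2) ^ 2 := by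
    rw [show (4 : ℕ) = 2 * 2 from rfl, pow_mul, norm_waveVec_e0_sq]
  have hK0 : 0 < (2 * Real.pi / L) ^ 2 := by positivity
  -- the second moment in closed form
  have hm2 : secondMoment (n + 1) L (waveFun n L ε) e0 =
      ((n : ℝ) + 1) * ((2 * Real.pi / L) ^ 2) ^ 2 * ((1 + 10 * s) / (1 + 2 * s)) := by
    rw [secondMoment_waveFun hL ε, hε2]
  have hfrac1 : 1 ≤ (1 + 10 * s) / (1 + 2 * s) := by
    rw [le_div_iff₀ (by positivity)]; linarith
  have hfrac2 : (1 + 10 * s) / (1 + 2 * s) ≤ 2 := by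
    rw [div_le_iff₀ (by positivity)]; linarith
  refine ⟨waveState n hL ε, ?_, waveFun_eq_norm hL hε, waveFun_ne_zero hL hε, ?_, ?_, ?_, ?_, ?_, ?_⟩
  · -- energy
    refine (periodicEnergy_waveState_le hL).trans (ENNReal.ofReal_le_ofReal ?_)
    rw [hε2, div_le_iff₀ (by positivity : (0 : ℝ) < L ^ 2)]
    have h2 : s ≤ δ * L ^ 2 / (16 * Real.pi ^ 2 * ((n : ℝ) + 1)) := min_le_right _ _
    rw [le_div_iff₀ (by positivity)] at h2
    linarith
  · -- Lévy weight
    have hν := levyWeight_waveState_ge (n := n) hL hε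
    rw [← hT]
    have h78 : (7 / 8) * s ≤ ε ^ 2 * (1 - 2 * ε ^ 2) := by rw [hε2]; nlinarith
    calc (7 / 8) * (((n : ℝ) + 1) * s) = ((n : ℝ) + 1) * ((7 / 8) * s) := by ring
      _ ≤ ((n : ℝ) + 1) * (ε ^ 2 * (1 - 2 * ε ^ 2)) := mul_le_mul_of_nonneg_left h78 hN.le
      _ ≤ ((n : ℝ) + 1) * levyWeight n L (waveState n hL ε) e0 := mul_le_mul_of_nonneg_left hν hN.le
  · -- structure factor
    have hS := structureFactor_waveState_ge (n := n) hL hε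
    rw [← hT]
    have h3 : 3 * s ≤ (2 * ε / (1 + 2 * ε ^ 2)) ^ 2 := by
      rw [div_pow, le_div_iff₀ (by positivity), mul_pow, hε2,
        show ((2 : ℝ) ^ 2) = 4 by norm_num]
      nlinarith [sq_nonneg s]
    calc 3 * (((n : ℝ) + 1) * s) = ((n : ℝ) + 1) * (3 * s) := by ring
      _ ≤ ((n : ℝ) + 1) * (2 * ε / (1 + 2 * ε ^ 2)) ^ 2 := mul_le_mul_of_nonneg_left h3 hN.le
      _ ≤ structureFactor n L (waveState n hL ε) e0 := hS
  · -- m₂ lower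
    show ((n : ℝ) + 1) * ‖waveVec L e0‖ ^ 4 ≤ secondMoment (n + 1) L (waveFun n L ε) e0
    rw [hm2, hK]
    have : 0 ≤ ((n : ℝ) + 1) * ((2 * Real.pi / L) ^ 2) ^ 2 := by positivity
    nlinarith
  · -- m₂ upper
    show secondMoment (n + 1) L (waveFun n L ε) e0 ≤ 2 * ((n : ℝ) + 1) * ‖waveVec L e0‖ ^ 4
    rw [hm2, hK]
    have : 0 ≤ ((n : ℝ) + 1) * ((2 * Real.pi / L) ^ 2) ^ 2 := by positivity
    nlinarith
  · -- AM–GM rung for every continuous field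
    intro φ hφ
    have h := fisherTestV_le_secondMoment hL (waveState n hL ε) e0_ne_zero hφ
    refine h.trans ?_
    show 4 * secondMoment (n + 1) L (waveFun n L ε) e0 / (((n : ℝ) + 1) ^ 2 * ‖waveVec L e0‖ ^ 4) ≤
      8 / ((n : ℝ) + 1)
    rw [hm2, hK, div_le_div_iff₀ (by positivity) hN]
    have : 0 ≤ ((n : ℝ) + 1) ^ 2 * ((2 * Real.pi / L) ^ 2) ^ 2 := by positivity
    nlinarith
  · -- the centred affine field
    exact ⟨affineField ((n : ℝ) + 1)⁻¹ (waveMean n ε), (contDiff_affineField _ _).continuous,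
      fisherTestV_affineField_waveState_ge hL hε (by rw [hε2]; exact hs16)⟩

end Witness

/-! ### The four rungs are false without minimality -/

section Refutations

/-- DMD fails on the free near-minimisers: eventually in `N`, `4N²‖k‖⁴ν ≥ (7/2)·T·N‖k‖⁴ > 2C·N‖k‖⁴ ≥ C m₂`. [folklore] -/
theorem dmd_free_witness {ρ : ℝ} (hρ : 0 < ρ) {δ : ℝ} (hδ : 0 < δ) {C : ℝ} (hC : 0 ≤ C) :
    ∀ᶠ n : ℕ in atTop, ∃ Ψ : PeriodicTrialState (n + 1) (sideLength ρ (n + 1)),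
      periodicEnergy 0 Ψ ≤ ENNReal.ofReal δ ∧ (∀ X, Ψ.ψ X = (‖Ψ.ψ X‖ : ℂ)) ∧ (∀ X, Ψ.ψ X ≠ 0) ∧
        ¬ dmdBody C ρ n Ψ := by
  filter_upwards [eventually_lt_mul_witnessScale hρ hδ (by norm_num : (0 : ℝ) < 7 / 4) C] with n hn
  obtain ⟨Ψ, hE, hreal, hpos, hν, _hS, _hm2l, hm2u, _hJle, _hJge⟩ :=
    ladder_free_near_minimiser_witness hρ n hδ
  refine ⟨Ψ, hE, hreal, hpos, fun hP => ?_⟩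
  have h := hP e0 e0_ne_zero
  set T := min (((n : ℝ) + 1) / 16) (δ * sideLength ρ (n + 1) ^ 2 / (16 * Real.pi ^ 2)) with hT
  set N : ℝ := (n : ℝ) + 1 with hNdef
  set K4 : ℝ := ‖waveVec (sideLength ρ (n + 1)) e0‖ ^ 4 with hK4
  set ν := levyWeight n (sideLength ρ (n + 1)) Ψ e0
  set m₂ := secondMoment (n + 1) (sideLength ρ (n + 1)) Ψ.ψ e0
  have hN : 0 < N := by positivity
  have hK40 : 0 < K4 := pow_pos (norm_waveVec_pos (sideLength_succ_pos hρ n) e0_ne_zero) 4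
  have hA : 0 < N * K4 := mul_pos hN hK40
  have step1 : 4 * (N * K4) * ((7 / 8) * T) ≤ C * m₂ := by
    have e1 : 4 * N ^ 2 * K4 * ν = 4 * (N * K4) * (N * ν) := by ring
    rw [e1] at h
    exact le_trans (mul_le_mul_of_nonneg_left hν (by positivity)) h
  have step2 : C * m₂ ≤ C * (2 * N * K4) := mul_le_mul_of_nonneg_left hm2u hC
  have hfin : (7 / 2) * T * (N * K4) ≤ 2 * C * (N * K4) := by
    have e : 4 * (N * K4) * ((7 / 8) * T) = (7 / 2) * T * (N * K4) := by ring
    have e' : C * (2 * N * K4) = 2 * C * (N * K4) := by ring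
    linarith [step1, step2, e, e']
  have h72 : (7 / 2) * T ≤ 2 * C := le_of_mul_le_mul_right hfin hA
  linarith

/-- FS fails on the free near-minimisers: `(N S) m₂ ≥ 3T · N²‖k‖⁴ > C N²‖k‖⁴`. [folklore] -/
theorem fs_free_witness {ρ : ℝ} (hρ : 0 < ρ) {δ : ℝ} (hδ : 0 < δ) (C : ℝ) :
    ∀ᶠ n : ℕ in atTop, ∃ Ψ : PeriodicTrialState (n + 1) (sideLength ρ (n + 1)),
      periodicEnergy 0 Ψ ≤ ENNReal.ofReal δ ∧ (∀ X, Ψ.ψ X = (‖Ψ.ψ X‖ : ℂ)) ∧ (∀ X, Ψ.ψ X ≠ 0) ∧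
        ¬ fsBody C ρ n Ψ := by
  filter_upwards [eventually_lt_mul_witnessScale hρ hδ (by norm_num : (0 : ℝ) < 3) C] with n hn
  obtain ⟨Ψ, hE, hreal, hpos, _hν, hS, hm2l, _hm2u, _hJle, _hJge⟩ :=
    ladder_free_near_minimiser_witness hρ n hδ
  refine ⟨Ψ, hE, hreal, hpos, fun hP => ?_⟩
  have h := hP e0 e0_ne_zero
  set T := min (((n : ℝ) + 1) / 16) (δ * sideLength ρ (n + 1) ^ 2 / (16 * Real.pi ^ 2)) with hT
  set N : ℝ := (n : ℝ) + 1 with hNdef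
  set K4 : ℝ := ‖waveVec (sideLength ρ (n + 1)) e0‖ ^ 4 with hK4
  set S := structureFactor n (sideLength ρ (n + 1)) Ψ e0
  set m₂ := secondMoment (n + 1) (sideLength ρ (n + 1)) Ψ.ψ e0
  have hN : 0 < N := by positivity
  have hK40 : 0 < K4 := pow_pos (norm_waveVec_pos (sideLength_succ_pos hρ n) e0_ne_zero) 4
  have hB : 0 < N ^ 2 * K4 := by positivity
  have hT0 : 0 ≤ T := le_min (by positivity) (by positivity)
  have step1 : (N * (3 * T)) * (N * K4) ≤ (N * S) * m₂ :=
    mul_le_mul (mul_le_mul_of_nonneg_left hS hN.le) hm2l (by positivity)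
      ((mul_nonneg hN.le (by positivity)).trans (mul_le_mul_of_nonneg_left hS hN.le))
  have hfin : 3 * T * (N ^ 2 * K4) ≤ C * (N ^ 2 * K4) := by
    have e : (N * (3 * T)) * (N * K4) = 3 * T * (N ^ 2 * K4) := by ring
    linarith [step1, h, e]
  have h3 : 3 * T ≤ C := le_of_mul_le_mul_right hfin hB
  linarith

/-- FD-V fails on the free near-minimisers: every continuous `φ` has `J^V(φ) ≤ 8/N` (AM–GM rung +
`m₂ ≤ 2N‖k‖⁴`), so `16ν ≤ C J^V(φ)` forces `14 T ≤ 16 N ν ≤ 8C`. [folklore] -/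
theorem fdV_free_witness {ρ : ℝ} (hρ : 0 < ρ) {δ : ℝ} (hδ : 0 < δ) {C : ℝ} (hC : 0 ≤ C) :
    ∀ᶠ n : ℕ in atTop, ∃ Ψ : PeriodicTrialState (n + 1) (sideLength ρ (n + 1)),
      periodicEnergy 0 Ψ ≤ ENNReal.ofReal δ ∧ (∀ X, Ψ.ψ X = (‖Ψ.ψ X‖ : ℂ)) ∧ (∀ X, Ψ.ψ X ≠ 0) ∧
        ¬ fdVBody C ρ n Ψ := by
  filter_upwards [eventually_lt_mul_witnessScale hρ hδ (by norm_num : (0 : ℝ) < 7 / 4) C] with n hn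
  obtain ⟨Ψ, hE, hreal, hpos, hν, _hS, _hm2l, _hm2u, hJle, _hJge⟩ :=
    ladder_free_near_minimiser_witness hρ n hδ
  refine ⟨Ψ, hE, hreal, hpos, fun hP => ?_⟩
  obtain ⟨φ, hφ, hle⟩ := hP e0 e0_ne_zero
  set T := min (((n : ℝ) + 1) / 16) (δ * sideLength ρ (n + 1) ^ 2 / (16 * Real.pi ^ 2)) with hT
  set N : ℝ := (n : ℝ) + 1 with hNdef
  set ν := levyWeight n (sideLength ρ (n + 1)) Ψ e0
  set J := fisherTestV n (sideLength ρ (n + 1)) Ψ e0 φ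
  have hN : 0 < N := by positivity
  have a1 : 16 * ν ≤ C * (8 / N) := hle.trans (mul_le_mul_of_nonneg_left (hJle φ hφ) hC)
  have a2 : 16 * (N * ν) ≤ 8 * C := by
    have h1 := mul_le_mul_of_nonneg_left a1 hN.le
    have e : N * (C * (8 / N)) = 8 * C := by field_simp
    have e2 : N * (16 * ν) = 16 * (N * ν) := by ring
    linarith [h1, e, e2]
  linarith [hν, a2, hn]

/-- FG-V fails on the free near-minimisers: at the centred affine field `J^V ≥ (8/9)/N` while
`N S ≥ 3NT`, so `J^V·(N S) ≥ (8/3) T > C`. [folklore] -/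
theorem fgV_free_witness {ρ : ℝ} (hρ : 0 < ρ) {δ : ℝ} (hδ : 0 < δ) (C : ℝ) :
    ∀ᶠ n : ℕ in atTop, ∃ Ψ : PeriodicTrialState (n + 1) (sideLength ρ (n + 1)),
      periodicEnergy 0 Ψ ≤ ENNReal.ofReal δ ∧ (∀ X, Ψ.ψ X = (‖Ψ.ψ X‖ : ℂ)) ∧ (∀ X, Ψ.ψ X ≠ 0) ∧
        ¬ fgVBody C ρ n Ψ := by
  filter_upwards [eventually_lt_mul_witnessScale hρ hδ (by norm_num : (0 : ℝ) < 8 / 3) C] with n hn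
  obtain ⟨Ψ, hE, hreal, hpos, _hν, hS, _hm2l, _hm2u, _hJle, hJge⟩ :=
    ladder_free_near_minimiser_witness hρ n hδ
  refine ⟨Ψ, hE, hreal, hpos, fun hP => ?_⟩
  obtain ⟨φ, hφ, hJ⟩ := hJge
  have h := hP e0 e0_ne_zero φ hφ
  set T := min (((n : ℝ) + 1) / 16) (δ * sideLength ρ (n + 1) ^ 2 / (16 * Real.pi ^ 2)) with hT
  set N : ℝ := (n : ℝ) + 1 with hNdef
  set S := structureFactor n (sideLength ρ (n + 1)) Ψ e0
  set J := fisherTestV n (sideLength ρ (n + 1)) Ψ e0 φ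
  have hN : 0 < N := by positivity
  have hT0 : 0 ≤ T := le_min (by positivity) (by positivity)
  have hNS : 0 ≤ N * S := (mul_nonneg hN.le (by positivity)).trans (mul_le_mul_of_nonneg_left hS hN.le)
  have b1 : (8 / 9) / N * (N * S) ≤ J * (N * S) := mul_le_mul_of_nonneg_right hJ hNS
  have b2 : (8 / 9) / N * (N * (3 * T)) ≤ (8 / 9) / N * (N * S) :=
    mul_le_mul_of_nonneg_left (mul_le_mul_of_nonneg_left hS hN.le) (by positivity)
  have e : (8 / 9) / N * (N * (3 * T)) = (8 / 3) * T := by field_simp; ring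
  linarith [b1, b2, e, h, hn]

/-- **DMD NEEDS MINIMALITY (near-minimiser form).**  `DensityMomentDomination` with `E = E₀`
weakened to `E ≤ E₀ + δ` (`δ > 0` fixed before `N`) is FALSE (free density waves: `ν ≍ ε²`,
`m₂ ≈ N‖k‖⁴` — the commutator amplitude has no Bragg component). [folklore] -/
theorem not_dmdNearMinimisers : ¬ DensityMomentDominationNearMinimisers :=
  not_frameNear_of_free_witness fun _ρ hρ _δ hδ _C hC => dmd_free_witness hρ hδ hC

/-- **DMD NEEDS MINIMALITY.**  `DensityMomentDomination` with the minimiser hypothesis deleted is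
FALSE. [folklore] -/
theorem dmd_false_without_minimality : ¬ DensityMomentDominationWithoutMinimality :=
  not_frameWithout_of_free_witness fun _ρ hρ _δ hδ _C hC => dmd_free_witness hρ hδ hC

/-- **FEYNMAN SATURATION NEEDS MINIMALITY (near-minimiser form)**: `m₀ m₂ ≤ C m₁²` fails for
`δ`-near-minimisers (`m₀ = N S ≍ ε²N²` is a Bragg peak while `m₂ ≈ m₁²/N`). [folklore] -/
theorem not_fsNearMinimisers : ¬ FeynmanSaturationNearMinimisers :=
  not_frameNear_of_free_witness fun _ρ hρ _δ hδ C _hC => fs_free_witness hρ hδ C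

/-- **FEYNMAN SATURATION NEEDS MINIMALITY.** [folklore] -/
theorem fs_false_without_minimality : ¬ FeynmanSaturationWithoutMinimality :=
  not_frameWithout_of_free_witness fun _ρ hρ _δ hδ C _hC => fs_free_witness hρ hδ C

/-- **FD (registered V-form) NEEDS MINIMALITY (near-minimiser form)**: for `δ`-near-minimisers the
lifted Fisher information `sup_φ J^V ≤ 4m₂/(N²‖k‖⁴) = O(1/N)` (AM–GM rung) while `16ν ≍ ε²` — so
`FisherDominationV` with `E ≤ E₀ + δ` is FALSE.  This is the generation-1 near-miss
(`FD also needs minimality`), closed in the form now registered (`stub_phaseSteinDomination` is the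
Stein rewriting of this `J^V`). [folklore] -/
theorem not_fdVNearMinimisers : ¬ FisherDominationVNearMinimisers :=
  not_frameNear_of_free_witness fun _ρ hρ _δ hδ _C hC => fdV_free_witness hρ hδ hC

/-- **FD (registered V-form) NEEDS MINIMALITY.** [folklore] -/
theorem fdV_false_without_minimality : ¬ FisherDominationVWithoutMinimality :=
  not_frameWithout_of_free_witness fun _ρ hρ _δ hδ _C hC => fdV_free_witness hρ hδ hC

/-- **FG (registered V-form, = `stub_densityFisherGaussianity`) NEEDS MINIMALITY (near-minimiser
form)**: the centred affine field gives `J^V·(N S) ≥ (8/3)·min(N/16, δL²/(16π²)) → ∞`. [folklore] -/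
theorem not_fgVNearMinimisers : ¬ FisherGaussianityVNearMinimisers :=
  not_frameNear_of_free_witness fun _ρ hρ _δ hδ C _hC => fgV_free_witness hρ hδ C

/-- **FG (registered V-form) NEEDS MINIMALITY.** [folklore] -/
theorem fgV_false_without_minimality : ¬ FisherGaussianityVWithoutMinimality :=
  not_frameWithout_of_free_witness fun _ρ hρ _δ hδ C _hC => fgV_free_witness hρ hδ C

/-- The four registered/typed rungs are STRENGTHENED by their near-minimiser versions (so the
refutations above say: any proof of DMD / FS / FD-V / FG-V must use exact minimality below every
`N`-uniform energy resolution — quantitatively below `δ_N` with `δ_N L_N² → ∞`). [folklore] -/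
theorem rungs_of_nearMinimisers :
    (DensityMomentDominationNearMinimisers → DensityMomentDomination) ∧
    (FeynmanSaturationNearMinimisers → FeynmanSaturation) ∧
    (FisherDominationVNearMinimisers → FisherDominationV) ∧
    (FisherGaussianityVNearMinimisers → FisherGaussianityV) :=
  ⟨cruxFrame_of_frameNear, cruxFrame_of_frameNear, cruxFrame_of_frameNear, cruxFrame_of_frameNear⟩

end Refutations

/-! ## §G  Near-misses — NONE open in generation 2

The generation-1 near-miss `not_fisherDominationWithoutMinimality_nearMiss` (planar `fisherTest`
form of FD, then `sorry`) is SUPERSEDED: the registered stub is now the V/Stein form, and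
`not_fdVNearMinimisers` / `fdV_false_without_minimality` (§H) prove that form false without
minimality, sorry-free.  (The planar form differs from the V-form by the `Z_{2m}`-term
`(4/N)Re E[conj ∂̄φ(Z)·Z_{2m}]`; it is no longer registered and is not pursued.) -/

/-! ## §D  Targets (generation 2) -/

/-- `-- Targets`, generation 2 (payload `targets = []`, `stuck_stubs = []`; the lead's reshaped
skeleton r1 of 2026-08-16T02:29:50Z registers `stub_steinIdentity`, `stub_weakEulerLagrange`,
`stub_coherenceRegular`, `stub_phaseSteinDomination`, `stub_densityFisherGaussianity`).

* `stub_steinIdentity` (`∫Re[conj φ(Z)·W·Ψ̄] = ‖k‖²∫Re[N∂φ(Z) − ∂̄φ(Z)·conj(∑ⱼeⱼ²)]|Ψ|²`, real `Ψ`,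
  `C¹ φ`): **TRUE as typed** — refuter re-derivation by one periodic integration by parts per slot with
  the tree's conventions checked symbol by symbol: `cellWave L m x = e^{+2πi m·x/L}` (`cellWave_apply`),
  hence `∇ⱼeⱼ = ik eⱼ` and `[−Δⱼ, eⱼ]Ψ = eⱼ(‖k‖²Ψ − 2ik·∇ⱼΨ)` = the typed `commutatorAmp`; Wirtinger
  `∂φ = (Dφ·1 − iDφ·i)/2`, `∂̄φ = (Dφ·1 + iDφ·i)/2` as typed; the `conj φ(Z)·Z`-terms cancel between
  the `‖k‖²` part and the boundary-free by-parts term, leaving exactly the typed right side (sign of the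
  `∂̄φ·conj(∑eⱼ²)` term included).  Independent consistency checks LANDED here (§H): on the density wave
  the f-sum pairing is `N‖k‖²` and the `Z`-pairing is `−‖k‖²E[Z_{2e₀}] = −N‖k‖²ε²/(1+2ε²)`, as the
  identity predicts for `φ(z) = z` and `φ(z) = z̄`.  (The co-lead r-0 reports it kernel-checked; nothing
  to attack.)
* `stub_weakEulerLagrange` (weak eigen-equation of a minimiser against `C¹` periodic symmetric `η`,
  real part): **TRUE as typed** — first variation of `t ↦ E(Ψ+tη)/‖Ψ+tη‖²` at `t = 0` inside the
  admissible class (`Ψ + tη` is `C¹`, periodic, symmetric; `E(η) < ∞` because `v^per` is bounded for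
  the smooth class and `∇η` is bounded), with `periodicEnergy = ∫(∑|∂_{ik}Ψ|² + V|Ψ|²)` (`kineticDensity`
  = sum of squared partials, no `1/2`), `E₀ = inf` over the SAME class (`periodicGroundStateEnergy`), and
  `‖Ψ‖ = 1` (`norm_eq`): `Re⟨η,(H−E₀)Ψ⟩_form = 0` is exactly the typed identity.  No junk (`toReal` of
  finite quantities; all integrands continuous on the bounded cell).  Caveat for the lead (r-0's
  ANALYSIS note, which this seat endorses): against test functions `η = fΨ` it only returns the
  positivity of the Dirichlet form of `μ = Ψ²dX`, true for EVERY positive state — and §H shows FD-V is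
  FALSE for some positive states (density waves) — so the core stub must use the E–L equation in a form
  that separates minimisers from `δ`-near-minimisers (pointwise `−ΔΨ + WΨ = E₀Ψ`, i.e. the potential
  `W` explicitly), not quadratic-form positivity.
* `stub_coherenceRegular` (`g` continuous, `> 0`, `≤ 1`, `g(0) = 1`, even, `L`-periodic, for `Ψ ≠ 0`):
  **TRUE as typed** (`coherence_le_one/zero/nonneg` landed in `Negative/CoherenceBounds.lean`; positivity:
  continuous positive integrand; evenness/periodicity: torus shift / `Ψ.periodic`).  Nothing to attack.
* `stub_phaseSteinDomination` (FD in Stein form, with weak E–L, `g` continuous, `g > 0` as extra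
  hypotheses): equivalent for minimisers to `FisherDominationV`, a PROVED consequence of the crux
  (`fisherDomination_of_imu`), hence not killable without killing the crux; with the optimal linear field
  it IS the crux.  **NEW (§H): FALSE without minimality** (`not_fdVNearMinimisers`: at any `N`-uniform
  slack `δ`, `sup_φ J^V ≤ 8/N` on the free density waves while `16ν ≍ ε²`), quantitatively at every slack
  `δ_N` with `δ_N L_N² → ∞`.
* `stub_densityFisherGaussianity` (FG-V, `∀ φ` continuous, `J^V·(NS) ≤ C`): true at `v ≡ 0` with the
  sharp `C = 4` (landed `fisherGaussianity_free`); `C ≥ 4` is forced on every real state by the linear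
  field (f-sum + Cramér–Rao: `J^V(−λz)·NS = (4λ − λ²NS)NS = 4` at `λ = 2/(NS)`); **NEW (§H): FALSE without
  minimality** (`not_fgVNearMinimisers`, centred affine field).  For minimisers: a Fisher-local-CLT for
  `(Z_m, Z_{2m})` at the anomalous scale `√(NS_m)`; regression form `‖E[A|Z]‖²·S ≤ (C/4)N‖k‖⁴`;
  Bogoliubov-exact, census-consistent; no cheap kill.
* Typed fallbacks: `StructureFactorCeiling` FALSE at `v ≡ 0` (drefute 02:19Z); `DensityMomentDomination`
  and `FeynmanSaturation` TRUE at `v ≡ 0` (constants) but **FALSE without minimality** (§H);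
  `SecondMomentBound` true at `v ≡ 0` AND on the density waves (`m₂ ≈ N‖k‖⁴ ≤ N‖k‖³√(‖k‖²+ρ)`) — the
  only rung the density-wave test-bed does not bite. -/
theorem targets_note_gen2 : True := trivial

end Summit.AtomisticToContinuum.BoseEinsteinCondensation.Cruxes.InfraredMinimumUncertainty.Disproof

end
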